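import Mathlib
import Summits.ValiantsHypothesis.ValiantsHypothesis.Theorems.LacunarySymmetroidMatrixDescartesDoorA26WallBubblingWeylGenericReduction
import Summits.ValiantsHypothesis.ValiantsHypothesis.Theorems.LacunarySymmetroidMatrixDescartesDoorA26WallBubblingWeylGenericReductionNC
import Summits.ValiantsHypothesis.ValiantsHypothesis.Theorems.LacunarySymmetroidMatrixDescartesDoorA26WallBubblingOnePairWallClosure
import Summits.ValiantsHypothesis.ValiantsHypothesis.Theorems.LacunarySymmetroidMatrixDescartesDoorA26WallBubblingDeepValStratumReduction
import Summits.ValiantsHypothesis.ValiantsHypothesis.Theorems.LacunarySymmetroidMatrixDescartesDoorA26WallBubblingTwoPairChain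
import Summits.ValiantsHypothesis.ValiantsHypothesis.Theorems.LacunarySymmetroidMatrixDescartesDoorA26WallBubblingWallStratumReduction
import Summits.ValiantsHypothesis.ValiantsHypothesis.Theorems.LacunarySymmetroidMatrixDescartesDoorA26WallBubblingDoublyConfluentNondegWallC1
import Summits.ValiantsHypothesis.ValiantsHypothesis.Theorems.LacunarySymmetroidMatrixDescartesDoorA26WallBubblingDoublyConfluentNondegWallC2
import Summits.ValiantsHypothesis.ValiantsHypothesis.Theorems.LacunarySymmetroidMatrixDescartesDoorA26WallBubblingMixTop
import Summits.ValiantsHypothesis.ValiantsHypothesis.Theorems.LacunarySymmetroidMatrixDescartesDoorA26WallBubblingMixMid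
import Summits.ValiantsHypothesis.ValiantsHypothesis.Theorems.LacunarySymmetroidMatrixDescartesDoorA26WallBubblingMixThree
import Summits.ValiantsHypothesis.ValiantsHypothesis.Theorems.LacunarySymmetroidMatrixDescartesDoorA26WallBubblingWallClosure
import Summits.ValiantsHypothesis.ValiantsHypothesis.Theorems.LacunarySymmetroidMatrixDescartesDoorA26WallBubblingValueGenericTwoPairChain
import Summits.ValiantsHypothesis.ValiantsHypothesis.Theorems.LacunarySymmetroidMatrixDescartesDoorA26WallBubblingValueGenericThreePairChain

/-!
# wall_bubbling — (W) at GENERIC WEYL FACES: the CONFLUENT DOOR `ConfluentDoor26` — STATEMENT FILE (defs + logical splits)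

**rev 13 (line lead val-idea-15 g7, 2026-08-29 ≈08:1xZ): rev 12 + ONE KERNEL LINK BY NAME + the four-hypothesis ledger, nothing else changed (pure insertion:
one import, this paragraph, three declarations).**  W1 door-p2 g14's #79
`Theorems/LacunarySymmetroidMatrixDescartesDoorA26WallBubblingValueGenericThreePairChain.lean` (p706782, tree bytes 268fb4e5f31f4665, std axioms) proves
`…WallBubbling.valueGenericThreePairChain`, whose statement is the body of `ValueGenericThreePairChain26` token-exact (crit-5 g5 P41/P42, desk R3091/R3093) ⇒
`ValueGenericThreePairChain26_holds`.  THE (W) LEDGER after rev 13 (`weylFaces_of_doorsNC_strata4`): «(W) ⟸ ConfluentDoor26 ∧ NoTightChain26NC ∧ (M) ∧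
TripleStratum26» — FOUR hypotheses, every one OPEN, typed, never asserted (`TripleStratum26` — Weyl triple, order-2 Newton frame, cancelling pattern
2E_ac − E_bb — untouched).  Nothing here asserts (W), (M), (R), any door, DoorA26 (19979) or 18050; VP ≠ VNP is not moved.

**rev 12 (line lead val-idea-15 g6, 2026-08-29 ≈06:5xZ): rev 11 + ONE KERNEL LINK BY NAME + the five-hypothesis ledger, nothing else changed.**  W1 door-p2 g14's
#63 `Theorems/LacunarySymmetroidMatrixDescartesDoorA26WallBubblingValueGenericTwoPairChain.lean` (p701493, tree bytes d9e22674b92340e6) proves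
`…WallBubbling.valueGenericTwoPairChain`, whose statement is the body of `ValueGenericTwoPairChain26` token-exact ⇒ `ValueGenericTwoPairChain26_holds`.  THE (W)
LEDGER after rev 12 (`weylFaces_of_doorsNC_strata5`): «(W) ⟸ ConfluentDoor26 ∧ NoTightChain26NC ∧ (M) ∧ ValueGenericThreePairChain26 ∧ TripleStratum26» — FIVE
hypotheses, every one OPEN, typed, never asserted (the three-pair chain is W1's announced #64–#76 programme; `TripleStratum26` untouched).  Nothing here asserts
(W), (M), (R), any door, DoorA26 (19979) or 18050; VP ≠ VNP is not moved.

**rev 11 (line lead val-idea-15 g6, 2026-08-29 ≈06:4xZ): rev 10 + KERNEL LINKS BY NAME, nothing else changed in any existing declaration.**  W1 door-p2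
g14's chain of record is ACCEPTED: #55 `…WallBubblingMixMid` (p698802, `mixMid_face`) ⇒ `MixMid26_holds`; #60 `…WallBubblingMixThree` (p700713,
`mixThree_face'`, statement = the body of `MixThree26'` line-exact) ⇒ `MixThree26'_holds`; #62 `…WallBubblingWallClosure` (p701060 @ee6351b9239b,
`weylFaces_wall_closed`: (W_wall) with its predicates inlined, door-free, hypothesis-free) ⇒ `Stmt.weylFaces_wall_holds : Stmt.weylFaces_wall`, whence
`weylFaces_wall_multiPair_holds` and the rev-9 re-link target `weylFaces_wall_of_mixedRulesR_holds` close by restriction / weakening.  THE (W) LEDGER after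
rev 11 (kernel bookkeeping, `weylFaces_of_doorsNC_strata_wallClosed`): «(W) ⟸ ConfluentDoor26 ∧ NoTightChain26NC ∧ (M) ∧ ValueGenericTwoPairChain26 ∧
ValueGenericThreePairChain26 ∧ TripleStratum26» — SIX hypotheses, every one OPEN, typed, never asserted; (W_wall) is no longer among them.  Nothing here
asserts (W), (M), (R), any door, DoorA26 (19979) or 18050; VP ≠ VNP is not moved.

**rev 10 (line lead val-idea-15 g6, 2026-08-29 ≈06Z): rev 9 + ONE KERNEL LINK, nothing else changed.**  W1 door-p2 g14's #54
`Theorems/LacunarySymmetroidMatrixDescartesDoorA26WallBubblingMixTop.lean` (p698220, ACCEPTED 05:13:27Z, commit 9e9db086175b, tree bytes 63d19b35a71e4063)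
proves `…WallBubbling.mixTop_face`, whose statement is the body of `MixTop26` (face form, all matrices); the link `MixTop26_holds : MixTop26` below is
that theorem BY NAME (the verbatim copy unfolds definitionally).  `MixMid26` (W1 #55) and `MixThree26'` (W1's THREE′ files) remain OPEN here until
their p-numbers are ACCEPTED; the re-link `Stmt.weylFaces_wall_of_mixedRulesR` remains OPEN until #52′.  Nothing else is asserted.

**rev 9 (line lead val-idea-15 g6, 2026-08-29 ≈05:4xZ): rev 8 + THE C′ RETYPE OF THE THREE-SCALE RULE, nothing else changed in any existing declaration.  RECORD (desk R3020 (A) ★ (W) LEDGER CORRECTION, R3024 (W) REPAIR TEXT, R3025 (A), R3026 (B)): crit-5 g4 executed the P2 health test of VERDICT #7 and it bit — rev-8 `MixThree26` (l.683–729 of rev 8, U quantified over ALL of M₂(ℝ)) is **FALSE AS TYPED** (kernel, std axioms: `Crit5MixThree.hMixThree_false (δ0) (h50) (h41) (hMixThree : ‹W1 #52 l.101–145 verbatim›) : False`, file `g4/i15chk/W52_hMixThree_false.lean` sha16 8659179a23384541; `not_mixThree26L : ¬ MixThree26L` on a verbatim copy, `g4/i15chk/NotMixThree_dev.lean` 07b279c3987f6a57;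 by-module `not_MixThree26` pending the Cruxes build; evidence #41/#42 on 19979; witness = the totally isotropic PLANES of `polar` on M₂(ℝ) (signature (2,2)): class {0,5} in ⟨E₁₁,E₁₂⟩, class {1,4} in ⟨E₂₁,E₂₂⟩, at EVERY face point δ0), hence W1 #52 `twoPair_noTwenties_of_mixedRules` / #53 are VACUOUSLY TRUE as landed and rev 8's links `weylFaces_wall_of_mixedRules'` / `weylFaces_of_doorsNC_mixedRules` carry no content (their hypothesis `MixThree26` is refuted) — they stay in the file as typed, annotated, as the settled negative edge; CLASS misstated, repair C′ = ONE BINDER: **`MixThree26'`** := rev-8 `MixThree26` with `(∀ ν l, (U ν l).IsSymm) →` inserted immediately after the `U` binder (crit-5's C′ text, frozen 05:09:39Z by R3024; WITH door-p2 g14's extra binder `δ0 0 ≠ δ0 1 →` after the face equalities, stated on the bus before the freeze and not objected to by crit-5 (R3024 (iii), R3026 (B))) — on Sym₂(ℝ) `det` has signature (1,2), isotropic LINES only, and crit-5's witness does not bite; C′-THREE is OPEN (crit-5: in the ansatz forced when δ0₀ ≠ δ0₁ the cross block is rank one and each class ratio is bounded at ≤ 1 of the 3 scales — a pigeonhole SKETCH,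 the W1 successor's theorem to prove; near-isotropic symmetric configurations not analysed).  `MixTop26` and `MixMid26` stay BYTE-IDENTICAL to rev 8 (R3025: TOP is about to be a theorem AS TYPED, all matrices, whole face — W1 door-p2 g14 #54 `Theorems/…DoorA26WallBubblingMixTop.lean` 63d19b35a71e4063, `mixTop_face`, crit-5 GO; the by-name link `MixTop26_holds : MixTop26` enters this file in the rev after #54 is ACCEPTED and built; MID: W1 #55 announced on the un-primed form, TRUE on paper by two-scale domination — crit-2 g5 note 0b6a7da57c861cfa, crit-5 CONCUR; P1 no-junk is moot for a proved rule and stays owed for MID until #55 lands).  RE-LINK: the typed target `Stmt.weylFaces_wall_of_mixedRulesR := MixTop26 → MixMid26 → MixThree26' → Stmt.weylFaces_wall` (OPEN here until W1's retyped #52′ lands — then proved exactly as rev 8 proved the unprimed link, #43 ∘ #52′ ∘ #26d/#26b at the face, in the next rev) and the kernel ledger `weylFaces_of_doorsNC_mixedRulesR` CONDITIONAL on it.  THE (W) LEDGER after rev 9: «(W) ⟸ ConfluentDoor26 ∧ NoTightChain26NC ∧ (M) ∧ ValueGenericTwoPairChain26 ∧ ValueGenericThreePairChain26 ∧ TripleStratum26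 ∧ MixTop26 ∧ MixMid26 ∧ MixThree26' ∧ (the re-link)» — every conjunct OPEN except that TOP is kernel-pending; once TOP/MID are kernel «the multi-pair residual of (W_wall) is EXACTLY C′-THREE» (R3024 (v)).  Nothing here asserts (W), (M), (R), any door, DoorA26 (19979) or 18050; VP ≠ VNP is not moved.**

**rev 7 (line lead val-idea-15 g5, 2026-08-29 ≈02Z): rev 6 + the kernel links of W1 door-p2 g13 #42 `…OnePairWallClosure` and #44 `…DeepValStratumReduction` (both ACCEPTED, def-free, predicates inlined verbatim — every copy unfolds definitionally).  (a) ONE WEYL PAIR ON A WALL: `Stmt.weylFaces_wall_onePair` (= (W_wall) ∧ `IsOnePairWall δ`, W1's `honePair`) is PROVED OUTRIGHT, door-free, by `weylFaces_wall_onePair_holds` := W1 #42 `not_mem_closure_twentyLocus_onePairWall`; the rest of (W_wall) is `Stmt.weylFaces_wall_multiPair` (two Weyl pairs on a wall = the (c1)/(c2)/(c3) strata, multi-cluster branch; single-cluster branch W1 #28), `weylFaces_wall_of_multiPair`.  (b) (W_deepVal) STRATIFIED: `ValueGenericTwoPairChain26` / `ValueGenericThreePairChain26` / `TripleStratum26`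 are #44's binders `hVG2` / `hVG3` / `hT` BYTE-EXACT and `weylFaces_deepVal_of_chains'` := W1 #44 `weylFaces_deepVal_of_chains` gives (W_deepVal) ⟸ the three; all three OPEN (two-pair chain: single-cluster branch W1 #28, multi-cluster needs two-dslope rungs; three-pair: single-cluster W1 #33; triple frame untouched).  (c) THE (W) LEDGER after rev 7, kernel-checked `weylFaces_of_doorsNC_strata`: **(W) ⟸ ConfluentDoor26 ∧ NoTightChain26NC ∧ (M) ∧ ValueGenericTwoPairChain26 ∧ ValueGenericThreePairChain26 ∧ TripleStratum26 ∧ (W_wall multi-pair)** — seven typed OPEN statements, none asserted; no declaration of rev 6 changed.**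
**rev 8 (line lead val-idea-15 g5, 2026-08-29 ≈05Z): rev 7 + the three MIXED-CLASS RULES of W1 door-p2 g13 #52/#53 typed in FACE FORM (`MixTop26`, `MixMid26`, `MixThree26`: `∀ δ0, δ0 5 = δ0 0 → δ0 4 = δ0 1 →` then #52's binders byte-exact — the binder decision forced by desk R2981: the δ0-free binders of #53 are refuted off the face by crit-2 g5 and are NOT linked) + the kernel link `weylFaces_wall_of_mixedRules' : MixTop26 → MixMid26 → MixThree26 → Stmt.weylFaces_wall` (#43 ∘ #52 ∘ #26d/#26b at the face) + the nine-hypothesis ledger `weylFaces_of_doorsNC_mixedRules`.  No existing declaration changed; additions only (3 defs, 2 theorems, 4 imports = #52, #43, #26d, #26b).**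

**rev 6 (line lead val-idea-15 g5, 2026-08-29): rev 5d + `NoTightChain26NC` — W2 door-p1 g15 #33 p681057 `…WeylGenericReductionNC`'s hypothesis `hchain` BYTE-EXACT from the tree (= #27's binder + the null-collapse premise(s) per cluster, discharged by W2 #32 `polar_eq_zero_iff_of_null_collapse` / `exists_smul_of_polar_eq_zero`); kernel links `weylFaces_generic_of_doorsNC : ConfluentDoor26 → NoTightChain26NC → Stmt.weylFaces_generic` (over W2 #33), `noTightChain26NC_of_noTightChain26` (drop the premise) and `weylFaces_of_doorsNC : ConfluentDoor26 → NoTightChain26NC → Stmt.weylFaces_deep → Stmt.stub_weylFaces`; so (W) ⟸ ConfluentDoor26 ∧ NoTightChain26NC ∧ (W_deep), and the combinatorial envelope of the NC residual is the post-collapse survivor set of the member-level census (5 154/10 830 at C = 2, 21 804/97 470 at C = 3; memo rev 13 §3.11). No other declaration changed; nothing asserted.**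
**rev 5d (header bookkeeping only: W1's landed three-pair and one-pair-on-wall series #30–#36 recorded under (W_deep)) · rev 5c (header bookkeeping only: W1's landed two-Weyl-pair series recorded under (W_deep); W2 #32 null collapse noted) · rev 5b (cosmetic, crit-5 VERDICT #4 (π-W3)): `set_option linter.dupNamespace false`; every door tagged `-- OPEN door (hypothesis only; never asserted)` above its docstring. No declaration changed.**
**rev 5 (2026-08-28 ≈ 23:3xZ, line lead val-idea-15 g4) — rev 4 + (a) THE TIGHT-CHAIN RESIDUAL `NoTightChain26` (W2 door-p1 g15 #27 p676823
`Theorems/…WallBubblingWeylGenericReduction.lean`, landed 23:10Z: `weylFaces_generic_of_confluentDoor_of_noTightChain : hdoor → hchain → …`; SIGNATURE FIRST bus 22:37:29Z, line lead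
NO VETO 22:43:23Z, desk R2843 (B): «(W)_generic ⇐ ConfluentDoor26 ∧ NoTightChain26» is THE SPLIT OF RECORD) — `NoTightChain26` is W2's `hchain` binder BYTE-EXACT from the tree file
(= pre-image 6a6bbef190e9ff6a; face normal form `δ0 5 = δ0 0`, 2-Sidon off the face; the setting and ALL conclusions of W2 #26 `tightChain` p676584 — Σ m c = 20, m c ≥ 1, drifts,
recentred zeros, per-cluster limit packages (μ, Γ = ε·polar(W,W), confluent det ≢ 0, C^∞ convergence), |V| = 15, L–P sharpness, member monotonicity, Σ_c(|Λ_c| − 1) = 14, tight slot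
splitting — then «2 ≤ C → False») over a verbatim local copy of `polar`; the one-cluster case C = 1 is `ConfluentDoor26` (W2 #16); (b) the two-input target shape
`Stmt.weylFaces_generic_of_confluentDoor_of_noTightChain := ConfluentDoor26 → NoTightChain26 → Stmt.weylFaces_generic` AND ITS KERNEL LINK `weylFaces_generic_of_doors` (this file now
imports W2 #27; the proof is W2's theorem applied to the line's own definitions — every verbatim copy unfolds definitionally), whence `weylFaces_of_doors : ConfluentDoor26 →
NoTightChain26 → Stmt.weylFaces_deep → Stmt.stub_weylFaces` (kernel bookkeeping); rev 3's one-input shape `Stmt.weylFaces_generic_of_confluentDoor` is kept as typed but is INSUFFICIENT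
(W2 g14 chain count) and superseded as a target; (c) the END-DEFICIT-2 DOORS `ConfluentDoor26TopDeficit2` / `ConfluentDoor26BottomDeficit2` (W2 g15 FLAG, bus 23:10:13Z): the C = 2
chain profile (18,2) / (2,18) survives every kernel rung, `ConfluentDoor26` and rev 4's deficit doors; killing it by a door needs «confluent letter extreme ∧ det T = 0 ∧ polar τ T = 0 ⇒
Σ mult ≤ 17» (one better than the Laguerre–Pólya count 18 of that configuration, as every door here is) — typed in rev 4's currency, OPEN, never asserted; the alternative is a genuine
two-scale linking argument.  Nothing in rev 5 asserts ConfluentDoor26, NoTightChain26, any deficit door, (W), DoorA26 or 18050.**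
**rev 4 (2026-08-28 ≈ 20Z) — rev 3 (778d8e89d906) + the two END-DEFICIT DOORS `ConfluentDoor26TopDeficit` / `ConfluentDoor26BottomDeficit` (door-p1 g14's (r2)
signature, bus 19:40:44Z, accepted by the line lead): the first named instances of the OPEN «(W-split) multi-scale linking» gap — chains that split
as (20,2)(a)/(b) resp. (2,20).  Same binders and currency as `ConfluentDoor26` (log-currency, zeros with multiplicity); OPEN; nothing else changed.**
**rev 3 (2026-08-28 17:2xZ) — supersedes 5b5918c79ceb (rev 2) and d8f5616fd7fb (rev 1).**  rev 3 = rev 2 + door-p1's binder request (bus 17:02:41Z):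
the HEADLINE door `ConfluentDoor26` is stated in the chain's LOG-CURRENCY (variable `t = log x ∈ ℝ`, `confluentDet e τ T S t := det(e^{e₀t}(τ + t·T) + Σ_k e^{e_{k+1}t} S_k)`,
zeros arbitrary reals, orders via `iteratedDeriv` in `t`) because the cluster functions, their windows and W2 #5 `multiplicity_transfer` all live in `t`; the `x`-form
(`confluentDetX`, `ConfluentDoor26X`) is kept as the cosmetic twin closer to `DoorA26`, with NO bridge claimed (vanishing order is invariant under `t ↦ e^t` — a Faà-di-Bruno
lemma nobody has typed; if ever needed it is an M-sized support item `ConfluentDoor26X → ConfluentDoor26`).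

**rev 2 (2026-08-28, line lead val-idea-15 g3) — superseded.**  Two changes, both forced on the bus within the
17:15Z window of R2687 (C) / R2689 (A): (1) CURRENCY (door-p1 g13 flag l.11908, desk lean (A), ADOPTED): the door is now typed WITH
MULTIPLICITY (`Σ ord ≤ 19` in derivative currency) because the only transfer from the confluent limit to its approximants is Rolle/Hurwitz-type
(merging zeros add multiplicity): `ncard ≤ 19` alone (18 simple + 1 double = multiplicity 20) would not exclude 20 approximant zeros; the
literal-set form survives as the weaker `ConfluentDoor26Card`, which does NOT feed the reduction.  (2) CORRECTION (door-p1 l.11924, R2689 (A)):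
the line lead's deeper-strata slot count `(r+1)(12−r)/2` (bus 16:38:22Z) and rev 1's bullet «deeper strata LEVEL-DEAD … CONFIRMED» are
WITHDRAWN — FALSE as counting statements: the span of `n` merging distinct exponentials keeps dimension `n` (Grassmannian limit; Vandermonde
inversion of the moments), so `slots(class) = #` distinct member exponents and the slot total is **21 at EVERY point of the simplex** (two Weyl
pairs `3+3+4+8+1+2 = 21`, triple `6+9+6 = 21`); the generic zero bound is 20 = one short EVERYWHERE.  What kills the deeper value-generic strata,
if anything, is ANATOMY not counting (door-p1 §68 (h): at two pairs the level-3 escape pins two opposite NULL pairs and `det N = det N′ = 0`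
drops the escape object to 19 slots unless `σ ∥ N` opens a sub-level — a finite recursion, paper first; at a triple the level-5 escape is a
Vandermonde-kernel pattern to be tested against `valueAnatomy` p649136).  Accordingly `Stmt.weylFaces_deep` is SPLIT (door-p1's recommendation,
ADOPTED): `Stmt.weylFaces_deepVal` (value-generic deeper strata; anatomy recursion, plausibly door-free, OPEN) and `Stmt.weylFaces_wall` (a Weyl
coincidence meeting a disjoint-type value coincidence with no mixed one; (D)-type with merged letters, OPEN); Weyl ∩ mixed-wall points are
literally inside (M) `Stmt.stub_mixedWalls` (which carries no `¬ HasWeylCoincidence` hypothesis) — `weylFaces_deep_of_split` is the kernel-checked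
bookkeeping `(M) → deepVal → wall → deep`.

Crux `DoorA26` (stmt-ValiantsHypothesis-19979, `= PosRootLawAt 2 6 19`, OPEN, never asserted here), line
`Cruxes/DoorA26/Lines/wall_bubbling.lean` @04ebf105c7df, obligation **(W)** `Stmt.stub_weylFaces`
(`∀ δ ∈ SortedSimplex, δ ∈ closure TwentyLocus → ¬ HasWeylCoincidence δ`: twenties do not ACCUMULATE at a point of the sorted
exponent simplex with a Weyl coincidence `δᵢ = δⱼ`).  Line lead val-idea-15 g3 (planner; critic of record val-idea-crit-5 g2,
shape critic crit-2 g3); W-seat on (W): val-sym-door-p1 g13 (W2).  UNREGISTERED (never `ledger skeleton check`); nothing in this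
file is a route item, a stub, or a claim about the crux.

## What is typed here and why (lead ruling R2675 (2), bus `pub-symmetroid/INBOX.md` 2026-08-28T16:16:34Z)

W2's paper ledger (door-p1 g13 report §68 (e)–(f), bus l.11772; kernel inputs: the first-order Weyl patterns p645311
`…WallBubblingWeylAnatomy`, their realisations p646228 `…WeylRealisable`, the stratum factorisation `…WeylStratum`): expand a
blown-up cluster of a sequence of twenties `δ^ν → δ*`, `δ*` on a GENERIC Weyl face (`δ*ᵢ = δ*ⱼ` and no other coincidence among the
pair sums than the ones this forces), in the slots `u^m e^{E u}`.  At the second level (class sums `≍ w = δⱼ^ν − δᵢ^ν`) the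
`u²`-slot is dead and the extended count gives `≤ 19 < 20` zeros — no accumulation.  The only escape is the THIRD level (class sums
`≍ w²`): the merging letters are asymptotically OPPOSITE and non-null, and the rescaled limit `f/w²` is the determinant of a
CONFLUENT symmetric `(2,6)` pencil — five distinct exponents, the exponent `δᵢ` carrying an affine letter `τ + u·T`
(`u = log x`; `T = −Tᵢ` in W2's notation):

  `F(x) = det ( x^{e₀}·(τ + log x · T) + Σ_{k<4} x^{e_{k+1}}·Sₖ )`,   `τ, T, Sₖ ∈ Sym₂(ℝ)`, `e` injective.

Slot count (extended exponential sum in `u`, `Σ_w P_w(u)e^{wu}`): `2e₀ ↦ det τ + u·2·polar(τ,T)… + u²·det T` (degree ≤ 2: 3 slots),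
`e₀+e_k ↦` degree ≤ 1 (4 × 2 = 8 slots), `e_k+e_l ↦ 6`, `2e_k ↦ 4`; `Σ (deg+1) = 21`, so the generic EXTENDED COUNT
(`extSum_card_zeros_le`, p646545 `…WallBubblingBubblingExtendedCount`) bounds the zeros by **20** — exactly the Descartes bound
of a sharp `(2,6)` pencil (21 classes).  The CONFLUENT DOOR asks for one less, **≤ 19**, as `DoorA26` does for genuine pencils;
a confluent pencil with 20 simple zeros would de-confluence (`δⱼ = δᵢ + w`, `Sⱼ = −Sᵢ + w·σ`, `w → 0`) into genuine `(2,6)`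
pencils with ≥ 20 zeros accumulating AT the face, i.e. refute `DoorA26` through (W).  (Reconciled with W2 on the bus 2026-08-28T16:31:08Z:
W2's «slot total 20» IS this zero bound 21 − 1; no slot is structurally dead at the third level — generic bound 20, door 19.)

RULING.  The confluent door is ADOPTED as the NORMAL FORM of (W) on the codimension-1 Weyl stratum.  This file TYPES:
* `confluentDet e τ T S` — the determinant above as a function of `t = log x` (rev 3: LOG-CURRENCY); `ConfluentDoor26` — the door WITH MULTIPLICITY: if the
  determinant is not identically zero, then for every finite set `Z ⊂ ℝ` and orders `m z` with `F, F′, …, F^{(m z − 1)}` vanishing at `z`, `Σ_{z∈Z} m z ≤ 19`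
  (derivative currency, `iteratedDeriv` in `t`; the robust counts of the Bubbling chain are Rolle-type and live in `t`, so this is the currency the reduction
  consumes); `confluentDetX` / `ConfluentDoor26X` — the same in the variable `x > 0` (rev 2's headline, cosmetic twin, no bridge claimed);
  `ConfluentDoor26Card` — rev 1's literal-set form (`ncard ≤ 19`), implied by `ConfluentDoor26X` (`confluentDoor26Card_of_confluentDoor26X`), the weaker reading;
* `IsGenericWeylFace δ i j` — `δᵢ = δⱼ` (`i < j`) and the 15 pair sums of the five remaining values are pairwise distinct (so the only
  pair-sum coincidences at `δ` are the ones forced by `δᵢ = δⱼ`; in particular no second Weyl pair, no mixed / disjoint wall through `δ`);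
  `IsValueGeneric δ` — every coincidence of pair sums `δ_a + δ_b = δ_c + δ_d` is a coincidence of the value pairs;
* `Stmt.weylFaces_generic` — (W) restricted to generic faces — and `Stmt.weylFaces_deep` — (W) at the remaining (codim ≥ 2) Weyl points,
  split further into `Stmt.weylFaces_deepVal` / `Stmt.weylFaces_wall` as above; `weylFaces_of_generic_of_deep` and `weylFaces_deep_of_split`
  are the kernel-checked splits (pure logic);
* `Stmt.weylFaces_generic_of_confluentDoor := ConfluentDoor26 → Stmt.weylFaces_generic` — the TARGET SHAPE of W2's kernel reduction
  (`Theorems/LacunarySymmetroidMatrixDescartesDoorA26WallBubbling<Piece>.lean`, def-free with these definitions inlined verbatim,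
  `--supports stmt-ValiantsHypothesis-19979 --as helper`; honest size L).  If it needs the level bookkeeping as an explicit hypothesis, that
  hypothesis is W4 #5's statement verbatim («robust extended count», `…BubblingRobustExtendedCount`) plus, for the multiplicity transfer, a
  Rolle-type «robust count WITH multiplicity at the limit» in the same chain — no other named hypothesis.
* W2's answer on the hypothesis set (bus 16:31:08Z): the defs are FINE as stated; the reduction's other inputs are landed theorems by name
  (Bubbling chain `robust_term_count'`, W3 `…SecondOrder*` incl. `blowup_datum`, W2 #1–#4 incl. `valueAnatomy` p649136).

LANDED HELPERS OF RECORD FOR (W_deep) (rev 5c/5d; bookkeeping only — no new def, no decl of this file changed).  W1 (val-sym-door-p2 g13), the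
TWO-WEYL-PAIR SERIES, 9/9 ACCEPTED 2026-08-28 (`--supports stmt-ValiantsHypothesis-19979 --as helper`, def-free; ns
`…Theorems.LacunarySymmetroidMatrixDescartes.WallBubbling`): `…DoublyConfluentCount` p675280 · `…DoublyConfluentFrame` p676842 · `…DoublyConfluentNondeg`
p678236 · `…DoublyConfluentNondegWallC2` p678259 · `…NondegWallC3` p678430 · `…NondegWallC1` p678448 · `…DoublyConfluentLimit` p678461 ·
`…TwoWeylPairsSingleCluster` p678494 (`no_twenty_window_twoWeylPairs`, `_wallC1`, `_wallC2`, `_wallC3`; `no_boundedRatio_twenties_twoWeylPairs{,_wallC1,_wallC2,_wallC3}`)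
· `…TwoWeylPairsRelabelled` p678766 (`exists_perm_twoWeylPairs`, the `…_perm` transports).  WORD (W1, line lead concurs): «TWO WEYL PAIRS — THE SINGLE-CLUSTER
BRANCH IS DOOR-FREE (kernel)»: at every point of the sorted simplex with two Weyl pairs, four distinct values and no midpoint relation (the value-generic
stratum of `Stmt.weylFaces_deepVal` and the strata (c1)/(c2)/(c3) of `Stmt.weylFaces_wall`), twenties accumulating there SPLIT (x₂₀/x₁ → ∞); the
multi-cluster branch at those points is the chain machinery re-run (W1's located remark: the chain ceiling has slack one on every special stratum —
W2's call); three pairs and one pair on a wall LANDED too (W1, 2026-08-28, seat 16/16 ACCEPTED; recorded at rev 5d): `…ThreePairCount` p678987 · `…ThreePairFrame` p679000 · `…ThreePairNondeg` p679015 · `…ThreePairSingleCluster` p679239 (`no_twenty_window_threeWeylPairs`, `no_boundedRatio_twenties_threeWeylPairs`; count ≤ 17 by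
`…Bubbling.threePairDet_zerosWithMultiplicity_le_seventeen`) · `…OnePairWallLimit` p679399 · `…OnePairWallNondeg` p679405 · `…OnePairWallSingleCluster` p679417 (`no_twenty_window_onePairWallA/B`, `no_boundedRatio_twenties_onePairWallA/B`; count ≤ 19 by W1 #12 `confluentDoor_conclusion_of_coincidence`).
WORDS (W1; crit-5 g3 co-signed byte identity of all 13 series files; line lead concurs): «THE SINGLE-CLUSTER BRANCH OF `Stmt.weylFaces_wall` IS DOOR-FREE IN THE KERNEL — all five
sub-strata (one pair on wall (a)/(b) #36; two pairs (c1)/(c2)/(c3) #28)» and «so is the value-generic single-cluster branch of `Stmt.weylFaces_deepVal` at two pairs (#28) and three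
pairs (#33): twenties accumulating there SPLIT»; NOT covered: strata with a TRIPLE (cancelling pattern `2E_ac − E_bb` realisable — anatomy), two-pair points with a midpoint relation
((M)'s), and the MULTI-CLUSTER branch everywhere (chain count, slack one — W2's call; W1 #37–#39 slot counts / special-stratum ceilings in the gate).  (W-split) bookkeeping of record at this
revision: W2 #27 p676823 `…WeylGenericReduction` (linked below), W2 #28–#31 landed/landing, W2 #32 `…NullCollapse` (door-free profile exclusion; located
member-level census 5 676/10 830 at C = 2, 75 666/97 470 at C = 3 — memo `wall_bubbling_M-sieve.md` rev 13 §3.11).  Nothing here is asserted; all doors,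
`NoTightChain26`, (W)/(M)/(R) OPEN.

HONEST FRAMING.  `wall_bubbling` moves the door to the faces of the simplex and lowers it only on certified stars
(`not_mem_closure_twentyLocus_of_star_rows`, W1 #5); (W) at generic faces is DOOR-HARD in a boundary format — its value is this normal
form, which the census instruments can attack like the interior (cheapest falsifier of the multiplicity door: prescribed zeros WITH
multiplicity are still linear conditions on the coefficient vector — the P3″ method applies verbatim); the deeper value-generic strata are
OPEN (anatomy, not counting); Weyl ∩ walls are (M)/(D)-type.  Sorries of the line: 3 = (W)/(M)/(R).  This file: 0 `sorry`, 0 theorems about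
the crux; `DoorA26`, `MatrixDescartes` 18050 OPEN; VP ≠ VNP not moved.
-/

set_option linter.dupNamespace false

namespace Summit.ValiantsHypothesis.ValiantsHypothesis.Cruxes.DoorA26.WallBubbling.ConfluentDoor

open Set Topology

noncomputable section

/-- The open TWENTY-LOCUS `T ⊆ ℝ⁶` — verbatim copy of `WallBubbling.TwentyLocus` (line file l.87; the literal set of
`isOpen_twentyLocus_two_six`). -/
def TwentyLocus : Set (Fin 6 → ℝ) :=
  {δ | ∃ S : Fin 6 → Matrix (Fin 2) (Fin 2) ℝ, (∀ l, (S l).IsSymm) ∧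
    20 ≤ {x : ℝ | 0 < x ∧ (∑ l, (x ^ (δ l)) • S l).det = 0}.ncard}

/-- The compact sorted simplex `0 = δ₀ ≤ ⋯ ≤ δ₅ = 1` — verbatim copy of `WallBubbling.SortedSimplex` (line file l.92). -/
def SortedSimplex : Set (Fin 6 → ℝ) := {δ | Monotone δ ∧ δ 0 = 0 ∧ δ (Fin.last 5) = 1}

/-- Weyl coincidence `δᵢ = δⱼ` (`i ≠ j`) — verbatim copy of `WallBubbling.HasWeylCoincidence` (line file l.95). -/
def HasWeylCoincidence (δ : Fin 6 → ℝ) : Prop := ∃ i j : Fin 6, i ≠ j ∧ δ i = δ j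

/-- (W) — verbatim copy of the line's typed obligation `WallBubbling.Stmt.stub_weylFaces` (line file l.123). -/
def Stmt.stub_weylFaces : Prop :=
  ∀ δ ∈ SortedSimplex, δ ∈ closure TwentyLocus → ¬ HasWeylCoincidence δ

/-- **THE CONFLUENT DOOR `(2,6)`.**  A confluent real symmetric `2 × 2` pencil with five distinct real exponents — the exponent `e₀`
carrying an affine letter `τ + log x · T`, the other four ordinary letters: its determinant as a function of `t = log x ∈ ℝ` (LOG-CURRENCY, rev 3).  The DOOR below says it
has at most `19` real roots with multiplicity, one less than the generic extended count 20 (`Σ(deg+1) − 1`, 21 slots), as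
`DoorA26 = PosRootLawAt 2 6 19` is one less than the Descartes bound 20 of a sharp 21-class pencil. -/
def confluentDet (e : Fin 5 → ℝ) (τ T : Matrix (Fin 2) (Fin 2) ℝ) (S : Fin 4 → Matrix (Fin 2) (Fin 2) ℝ) (t : ℝ) : ℝ :=
  ((Real.exp (e 0 * t)) • (τ + t • T) + ∑ k, (Real.exp (e k.succ * t)) • S k).det

-- OPEN door (hypothesis only; never asserted)
/-- **The confluent (2,6) door, WITH MULTIPLICITY, LOG-CURRENCY** (rev 3 headline).  For injective exponents `e`, symmetric `τ, T, S_k`, if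
`confluentDet e τ T S` (a function of `t = log x ∈ ℝ`) is not identically zero, then its real zeros counted with multiplicity number at most `19`:
for every finite `Z ⊂ ℝ` and orders `m` with `iteratedDeriv j F z = 0` for all `j < m z` (`z ∈ Z`), `Σ_{z∈Z} m z ≤ 19`.  Generic extended count (with
multiplicity) = 20 (21 slots); the door is one less.  OPEN; exactly the hypothesis W2's reduction consumes after `multiplicity_transfer` (W2 #5). -/
def ConfluentDoor26 : Prop :=
  ∀ e : Fin 5 → ℝ, Function.Injective e →
  ∀ τ T : Matrix (Fin 2) (Fin 2) ℝ, ∀ S : Fin 4 → Matrix (Fin 2) (Fin 2) ℝ,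
    τ.IsSymm → T.IsSymm → (∀ k, (S k).IsSymm) →
    (∃ t, confluentDet e τ T S t ≠ 0) →
    ∀ (Z : Finset ℝ) (m : ℝ → ℕ),
      (∀ z ∈ Z, ∀ j < m z, iteratedDeriv j (confluentDet e τ T S) z = 0) →
      ∑ z ∈ Z, m z ≤ 19

-- OPEN door (hypothesis only; never asserted)
/-- **END-DEFICIT DOOR, TOP** (rev 4; door-p1 g14 (r2) 2026-08-28 19:40Z).  Same binders and currency as `ConfluentDoor26`.  If the
LEX-LAST of the 21 slots is DEAD — either the confluent exponent `e 0` is the top exponent and `T.det = 0` (the slot `t² e^{2 e₀ t}`), or an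
ordinary letter `S k` carries the top exponent and `(S k).det = 0` (the slot `e^{2 e_{k+1} t}`) — then the zeros with multiplicity number at most
`18`.  Content only when exactly that one slot is dead (span 20: the extended count gives 19, the door says 18; smaller spans are ≤ 18 by the
count alone).  It kills the (20,2)(a)/(b) splits of a twenty at a generic Weyl face; what `DoorA26` itself implies is only the DISTINCT-ZERO
version (de-confluence `S₅ := T/w + σ`, `S₄ := τ − T/w − σ`), the residual being MULTIPLICITY exactly as for `ConfluentDoor26`.  OPEN. -/
def ConfluentDoor26TopDeficit : Prop :=
  ∀ e : Fin 5 → ℝ, Function.Injective e →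
  ∀ τ T : Matrix (Fin 2) (Fin 2) ℝ, ∀ S : Fin 4 → Matrix (Fin 2) (Fin 2) ℝ,
    τ.IsSymm → T.IsSymm → (∀ k, (S k).IsSymm) →
    (∃ t, confluentDet e τ T S t ≠ 0) →
    (((∀ k : Fin 4, e k.succ < e 0) ∧ T.det = 0) ∨ (∃ k : Fin 4, (∀ k' : Fin 4, e k'.succ ≤ e k.succ) ∧ e 0 < e k.succ ∧ (S k).det = 0)) →
    ∀ (Z : Finset ℝ) (m : ℝ → ℕ),
      (∀ z ∈ Z, ∀ j < m z, iteratedDeriv j (confluentDet e τ T S) z = 0) →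
      ∑ z ∈ Z, m z ≤ 18

-- OPEN door (hypothesis only; never asserted)
/-- **END-DEFICIT DOOR, BOTTOM** (rev 4): the mirror of `ConfluentDoor26TopDeficit` under `t ↦ −t`
(`confluentDet e τ T S (−t) = confluentDet (−e) τ (−T) S t`, and `(−T).det = T.det` for 2×2): the LEX-FIRST slot is dead — either the confluent
exponent `e 0` is the BOTTOM exponent and `T.det = 0` (as `t → −∞` the extreme slot of the confluent cluster is again `t² e^{2 e₀ t}`), or an
ordinary letter `S k` carries the bottom exponent and `(S k).det = 0` — then at most `18` zeros with multiplicity.  It kills the (2,20) splits.  OPEN. -/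
def ConfluentDoor26BottomDeficit : Prop :=
  ∀ e : Fin 5 → ℝ, Function.Injective e →
  ∀ τ T : Matrix (Fin 2) (Fin 2) ℝ, ∀ S : Fin 4 → Matrix (Fin 2) (Fin 2) ℝ,
    τ.IsSymm → T.IsSymm → (∀ k, (S k).IsSymm) →
    (∃ t, confluentDet e τ T S t ≠ 0) →
    (((∀ k : Fin 4, e 0 < e k.succ) ∧ T.det = 0) ∨ (∃ k : Fin 4, (∀ k' : Fin 4, e k.succ ≤ e k'.succ) ∧ e k.succ < e 0 ∧ (S k).det = 0)) →
    ∀ (Z : Finset ℝ) (m : ℝ → ℕ),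
      (∀ z ∈ Z, ∀ j < m z, iteratedDeriv j (confluentDet e τ T S) z = 0) →
      ∑ z ∈ Z, m z ≤ 18

/-- verbatim copy (Theorems `…WallBubblingBubblingDefs`, namespace `…WallBubbling.Bubbling`): the polar form of `det` on 2×2 matrices
(`det (τ + t•T) = det τ + 2t·polar τ T + t²·det T`). -/
def polar (S T : Matrix (Fin 2) (Fin 2) ℝ) : ℝ := ((S + T).det - S.det - T.det) / 2

-- OPEN door (hypothesis only; never asserted)
/-- **END-DEFICIT-2 DOOR, TOP** (rev 5; W2 door-p1 g15 FLAG, bus 2026-08-28 23:10:13Z): the confluent letter is on TOP and BOTH its extra slots are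
dead — `T` null (the `t²`-slot of `2e₀`) AND `polar τ T = 0` (the `t`-slot) — then at most `17` zeros with multiplicity (the Laguerre–Pólya count of this
configuration is 18).  Needed for the C = 2 tight-chain profile (18,2): cluster 1 L–P-sharp on 19 slots with both confluent triple slots dead (m₁ = 18 —
exactly `ConfluentDoor26TopDeficit`'s bound, so rev 4's doors do not bite), cluster 2 = the triple `2α` with its `t²`-slot alive (m₂ = 2).  OPEN — typed
only, never asserted; the alternative to this door is a genuine two-scale linking argument. -/
def ConfluentDoor26TopDeficit2 : Prop :=
  ∀ e : Fin 5 → ℝ, Function.Injective e →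
  ∀ τ T : Matrix (Fin 2) (Fin 2) ℝ, ∀ S : Fin 4 → Matrix (Fin 2) (Fin 2) ℝ,
    τ.IsSymm → T.IsSymm → (∀ k, (S k).IsSymm) →
    (∃ t, confluentDet e τ T S t ≠ 0) →
    (∀ k : Fin 4, e k.succ < e 0) → T.det = 0 → polar τ T = 0 →
    ∀ (Z : Finset ℝ) (m : ℝ → ℕ),
      (∀ z ∈ Z, ∀ j < m z, iteratedDeriv j (confluentDet e τ T S) z = 0) →
      ∑ z ∈ Z, m z ≤ 17

-- OPEN door (hypothesis only; never asserted)
/-- **END-DEFICIT-2 DOOR, BOTTOM** (rev 5): the mirror of `ConfluentDoor26TopDeficit2` under `t ↦ −t` (`polar τ (−T) = −polar τ T`, `(−T).det = T.det`):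
confluent letter at the BOTTOM with both extra slots dead ⇒ at most `17` zeros with multiplicity; needed for the profile (2,18).  OPEN — typed only. -/
def ConfluentDoor26BottomDeficit2 : Prop :=
  ∀ e : Fin 5 → ℝ, Function.Injective e →
  ∀ τ T : Matrix (Fin 2) (Fin 2) ℝ, ∀ S : Fin 4 → Matrix (Fin 2) (Fin 2) ℝ,
    τ.IsSymm → T.IsSymm → (∀ k, (S k).IsSymm) →
    (∃ t, confluentDet e τ T S t ≠ 0) →
    (∀ k : Fin 4, e 0 < e k.succ) → T.det = 0 → polar τ T = 0 →
    ∀ (Z : Finset ℝ) (m : ℝ → ℕ),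
      (∀ z ∈ Z, ∀ j < m z, iteratedDeriv j (confluentDet e τ T S) z = 0) →
      ∑ z ∈ Z, m z ≤ 17

/-- the same determinant in the variable `x > 0` (`t = log x`): cosmetic twin, closer to `DoorA26`'s `x ^ δ` notation. -/
def confluentDetX (e : Fin 5 → ℝ) (τ T : Matrix (Fin 2) (Fin 2) ℝ) (S : Fin 4 → Matrix (Fin 2) (Fin 2) ℝ) (x : ℝ) : ℝ :=
  ((x ^ (e 0)) • (τ + (Real.log x) • T) + ∑ k, (x ^ (e k.succ)) • S k).det

-- OPEN door (hypothesis only; never asserted)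
/-- the `x`-currency multiplicity door (rev 2's headline; orders via `iteratedDeriv` in `x` at positive zeros).  Kept for the record; NO bridge to the
log form is claimed here (order of vanishing is invariant under the diffeomorphism `t ↦ e^t`, untyped). -/
def ConfluentDoor26X : Prop :=
  ∀ e : Fin 5 → ℝ, Function.Injective e →
  ∀ τ T : Matrix (Fin 2) (Fin 2) ℝ, ∀ S : Fin 4 → Matrix (Fin 2) (Fin 2) ℝ,
    τ.IsSymm → T.IsSymm → (∀ k, (S k).IsSymm) →
    (∃ x, 0 < x ∧ confluentDetX e τ T S x ≠ 0) →
    ∀ (Z : Finset ℝ) (m : ℝ → ℕ),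
      (∀ z ∈ Z, 0 < z ∧ ∀ j < m z, iteratedDeriv j (confluentDetX e τ T S) z = 0) →
      ∑ z ∈ Z, m z ≤ 19

-- OPEN door (hypothesis only; never asserted)
/-- rev 1's literal-set form of the door (`ncard` currency of `TwentyLocus`; an identically vanishing determinant has an infinite zero set,
`ncard = 0`).  WEAKER reading, kept for the record; it does NOT feed the reduction (door-p1 currency flag, bus l.11908). -/
def ConfluentDoor26Card : Prop :=
  ∀ e : Fin 5 → ℝ, Function.Injective e →
  ∀ τ T : Matrix (Fin 2) (Fin 2) ℝ, ∀ S : Fin 4 → Matrix (Fin 2) (Fin 2) ℝ,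
    τ.IsSymm → T.IsSymm → (∀ k, (S k).IsSymm) →
    {x : ℝ | 0 < x ∧ confluentDetX e τ T S x = 0}.ncard ≤ 19

/-- The `x`-currency multiplicity door implies the literal-set door (orders `m ≡ 1`). -/
theorem confluentDoor26Card_of_confluentDoor26X (h : ConfluentDoor26X) : ConfluentDoor26Card := by
  intro e he τ T S hτ hT hS
  by_cases hfin : {x : ℝ | 0 < x ∧ confluentDetX e τ T S x = 0}.Finite
  · by_cases hne : ∃ x, 0 < x ∧ confluentDetX e τ T S x ≠ 0
    · have key := h e he τ T S hτ hT hS hne hfin.toFinset (fun _ => 1) (by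
        intro z hz
        rw [Set.Finite.mem_toFinset] at hz
        refine ⟨hz.1, fun j hj => ?_⟩
        have : j = 0 := by omega
        subst this
        simpa using hz.2)
      simpa [Set.ncard_eq_toFinset_card _ hfin] using key
    · -- identically zero on (0,∞): the zero set is `Ioi 0`, infinite — contradiction with `hfin`
      exfalso
      simp only [not_exists, not_and, not_not] at hne
      apply (Set.Ioi_infinite (0 : ℝ))
      refine hfin.subset ?_
      intro x hx
      exact ⟨hx, hne x hx⟩
  · rw [Set.Infinite.ncard (by simpa using hfin)]
    omega

/-- `δ` lies on the GENERIC part of the Weyl face `δᵢ = δⱼ` (`i < j`): deleting the coordinate `j`, the 15 pair sums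
`δₐ + δ_b` (`a ≤ b` in `Fin 5`, re-indexed by `j.succAbove`) are pairwise distinct — so the only pair-sum coincidences at `δ` are the
ones forced by `δᵢ = δⱼ` (no second Weyl pair, no mixed or disjoint-pair wall through `δ`). -/
def IsGenericWeylFace (δ : Fin 6 → ℝ) (i j : Fin 6) : Prop :=
  i < j ∧ δ i = δ j ∧
    Set.InjOn (fun p : Fin 5 × Fin 5 => δ (j.succAbove p.1) + δ (j.succAbove p.2)) {p | p.1 ≤ p.2}

/-- (W_gen) — (W) on generic Weyl faces: no point of the sorted simplex on the generic part of a Weyl face is a limit of twenties. -/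
def Stmt.weylFaces_generic : Prop :=
  ∀ δ ∈ SortedSimplex, ∀ i j : Fin 6, IsGenericWeylFace δ i j → δ ∉ closure TwentyLocus

/-- (W_deep) — (W) at the remaining Weyl points (codimension ≥ 2 strata: a second Weyl pair, a triple, or a Weyl face meeting a
mixed / disjoint-pair wall): such a point of the sorted simplex is not a limit of twenties.  W2 #5 (paper first). -/
def Stmt.weylFaces_deep : Prop :=
  ∀ δ ∈ SortedSimplex, HasWeylCoincidence δ → (∀ i j : Fin 6, ¬ IsGenericWeylFace δ i j) → δ ∉ closure TwentyLocus

/-- verbatim copy (line file): a MIXED coincidence `2δᵢ = δ_k + δ_l` among three distinct letters. -/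
def HasMixedCoincidence (δ : Fin 6 → ℝ) : Prop :=
  ∃ i k l : Fin 6, i ≠ k ∧ i ≠ l ∧ k ≠ l ∧ 2 * δ i = δ k + δ l

/-- verbatim copy of the line's obligation (M) `Stmt.stub_mixedWalls` (note: no `¬ HasWeylCoincidence` hypothesis — Weyl ∩ mixed-wall
points are (M)'s). -/
def Stmt.stub_mixedWalls : Prop :=
  ∀ δ ∈ SortedSimplex, δ ∈ closure TwentyLocus → ¬ HasMixedCoincidence δ

/-- `δ` is VALUE-GENERIC: every coincidence of pair sums is a coincidence of value pairs (no mixed / disjoint relation among the distinct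
VALUES of `δ`; Weyl coincidences `δ_a = δ_b` are allowed). -/
def IsValueGeneric (δ : Fin 6 → ℝ) : Prop :=
  ∀ a b c d : Fin 6, δ a + δ b = δ c + δ d → (δ a = δ c ∧ δ b = δ d) ∨ (δ a = δ d ∧ δ b = δ c)

/-- (W_deepVal) — (W) at the VALUE-GENERIC deeper Weyl strata (a second Weyl pair, a triple, …; no generic face through `δ`): door-p1 §68 (h),
anatomy recursion, paper first; OPEN. -/
def Stmt.weylFaces_deepVal : Prop :=
  ∀ δ ∈ SortedSimplex, HasWeylCoincidence δ → IsValueGeneric δ → (∀ i j : Fin 6, ¬ IsGenericWeylFace δ i j) → δ ∉ closure TwentyLocus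

/-- (W_wall) — (W) where a Weyl coincidence meets a DISJOINT-type value coincidence and no mixed one ((D)-type with merged letters; W1/W3
instruments); OPEN. -/
def Stmt.weylFaces_wall : Prop :=
  ∀ δ ∈ SortedSimplex, HasWeylCoincidence δ → ¬ HasMixedCoincidence δ → ¬ IsValueGeneric δ → δ ∉ closure TwentyLocus

/-- The deep part splits as (M) + value-generic deeper strata + Weyl ∩ disjoint-type walls — pure logic, kernel-checked. -/
theorem weylFaces_deep_of_split (hM : Stmt.stub_mixedWalls) (hv : Stmt.weylFaces_deepVal) (hw : Stmt.weylFaces_wall) :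
    Stmt.weylFaces_deep := by
  intro δ hδ hW hng hcl
  by_cases hvg : IsValueGeneric δ
  · exact hv δ hδ hW hvg hng hcl
  · by_cases hm : HasMixedCoincidence δ
    · exact hM δ hδ hcl hm
    · exact hw δ hδ hW hm hvg hcl

/-- TARGET SHAPE of W2's kernel reduction (file #4): the confluent door closes (W) on generic faces.  OPEN (typed only). -/
def Stmt.weylFaces_generic_of_confluentDoor : Prop :=
  ConfluentDoor26 → Stmt.weylFaces_generic

-- OPEN door (hypothesis only; never asserted)
open Finset Filter in
/-- (rev 5) `NoTightChain26` — THE TIGHT-CHAIN RESIDUAL of (W) at generic Weyl faces: «no tight confluent chain with at least two clusters».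
W2 door-p1 g15 #27's hypothesis `hchain`, BYTE-EXACT from the tree file: the setting (a sequence `δs → δ0` on the face `δ0 5 = δ0 0`, 2-Sidon off
the face, symmetric pencils `U ν` not identically singular, twenty strictly increasing zeros `z ν`) and every conclusion of W2 #26 `tightChain` along a
subsequence `φ` (cluster sizes `m` with `Σ m c = 20`, `1 ≤ m c`; drifts `s`; recentred zeros in `[−R, R]`; per-cluster packages `μ, Γ, ε, W` with
`Γ c = ε c • polar (W c) (W c)`, confluent determinant of `W c` not identically zero and `C^∞` convergence of the normalised determinants; `|V| = 15`;
Laguerre–Pólya sharpness of every cluster; member monotonicity across clusters; `Σ_c (|Λ_c| − 1) = 14`; tight slot splitting at every value `w`)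
imply `2 ≤ C → False`.  The case `C = 1` is `ConfluentDoor26`.  OPEN — typed only, never asserted; first named instances: rev 4's deficit doors and
rev 5's deficit-2 doors. -/
def NoTightChain26 : Prop :=
  ∀ (δs : ℕ → Fin 6 → ℝ) (δ0 : Fin 6 → ℝ),
    (∀ l, Tendsto (fun ν => δs ν l) atTop (𝓝 (δ0 l))) → δ0 5 = δ0 0 →
    (∀ a b c d : Fin 5, δ0 a.castSucc + δ0 b.castSucc = δ0 c.castSucc + δ0 d.castSucc → (a = c ∧ b = d) ∨ (a = d ∧ b = c)) →
    ∀ (U : ℕ → Fin 6 → Matrix (Fin 2) (Fin 2) ℝ), (∀ ν l, (U ν l).IsSymm) →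
    (∀ ν, ∃ t, (∑ l, Real.exp (δs ν l * t) • U ν l).det ≠ 0) →
    ∀ (z : ℕ → Fin 20 → ℝ), (∀ ν, StrictMono (z ν)) → (∀ ν i, (∑ l, Real.exp (δs ν l * z ν i) • U ν l).det = 0) →
    ∀ (φ : ℕ → ℕ), StrictMono φ →
    ∀ (C : ℕ) (m : Fin C → ℕ) (s : Fin C → ℕ → ℝ) (R : ℝ)
      (μ : Fin C → ℕ → ℝ) (Γ : Fin C → Fin 6 → Fin 6 → ℝ) (ε : Fin C → ℝ) (W : Fin C → Fin 6 → Matrix (Fin 2) (Fin 2) ℝ),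
    ∑ c, m c = 20 → (∀ c, 1 ≤ m c) →
    (∀ c c' : Fin C, c < c' → Tendsto (fun k => s c' k - s c k) atTop atTop) →
    (∀ (c : Fin C) (k : ℕ), ∃ x : Fin (m c) → ℝ, StrictMono x ∧ ∀ i, x i ∈ Set.Icc (-R) R ∧
      (∑ l, Real.exp (δs (φ k) l * x i) • (Real.exp (δs (φ k) l * s c k) • U (φ k) l)).det = 0) →
    (∀ c : Fin C,
      (∀ k, 0 < μ c k) ∧
      (∀ k a b, |polar
        (if a = 0 then Real.exp (δs (φ k) 0 * s c k) • U (φ k) 0 + Real.exp (δs (φ k) 5 * s c k) • U (φ k) 5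
          else if a = 5 then (δs (φ k) 5 - δs (φ k) 0) • (Real.exp (δs (φ k) 5 * s c k) • U (φ k) 5)
          else Real.exp (δs (φ k) a * s c k) • U (φ k) a)
        (if b = 0 then Real.exp (δs (φ k) 0 * s c k) • U (φ k) 0 + Real.exp (δs (φ k) 5 * s c k) • U (φ k) 5
          else if b = 5 then (δs (φ k) 5 - δs (φ k) 0) • (Real.exp (δs (φ k) 5 * s c k) • U (φ k) 5)
          else Real.exp (δs (φ k) b * s c k) • U (φ k) b)| ≤ μ c k) ∧
      (∀ a b, Tendsto (fun k => polar
        (if a = 0 then Real.exp (δs (φ k) 0 * s c k) • U (φ k) 0 + Real.exp (δs (φ k) 5 * s c k) • U (φ k) 5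
          else if a = 5 then (δs (φ k) 5 - δs (φ k) 0) • (Real.exp (δs (φ k) 5 * s c k) • U (φ k) 5)
          else Real.exp (δs (φ k) a * s c k) • U (φ k) a)
        (if b = 0 then Real.exp (δs (φ k) 0 * s c k) • U (φ k) 0 + Real.exp (δs (φ k) 5 * s c k) • U (φ k) 5
          else if b = 5 then (δs (φ k) 5 - δs (φ k) 0) • (Real.exp (δs (φ k) 5 * s c k) • U (φ k) 5)
          else Real.exp (δs (φ k) b * s c k) • U (φ k) b) / μ c k) atTop (𝓝 (Γ c a b))) ∧
      (ε c = 1 ∨ ε c = -1) ∧ (∀ l, (W c l).IsSymm) ∧ (∀ a b, Γ c a b = ε c * polar (W c a) (W c b)) ∧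
      (∃ t, ((Real.exp (δ0 0 * t)) • (W c 0 + t • W c 5)
        + ∑ k : Fin 4, (Real.exp (δ0 k.succ.castSucc * t)) • W c k.succ.castSucc).det ≠ 0) ∧
      ∀ (n : ℕ) (ψ : ℕ → ℕ), StrictMono ψ → ∀ (ts : ℕ → ℝ) (t₀ : ℝ), Tendsto ts atTop (𝓝 t₀) →
        Tendsto (fun k => iteratedDeriv n
            (fun t => ε c * (μ c (ψ k))⁻¹ *
              (∑ l, Real.exp (δs (φ (ψ k)) l * t) • (Real.exp (δs (φ (ψ k)) l * s c (ψ k)) • U (φ (ψ k)) l)).det) (ts k))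
          atTop (𝓝 (iteratedDeriv n
            (fun t => ((Real.exp (δ0 0 * t)) • (W c 0 + t • W c 5)
              + ∑ k : Fin 4, (Real.exp (δ0 k.succ.castSucc * t)) • W c k.succ.castSucc).det) t₀))) →
    ((univ : Finset (Fin 6 × Fin 6)).image (fun pq => δ0 pq.1 + δ0 pq.2)).card = 15 →
    (∀ c : Fin C, m c + 1 = ∑ w ∈ ((univ : Finset (Fin 6 × Fin 6)).image (fun pq => δ0 pq.1 + δ0 pq.2)).filter
        (fun w => (∃ p q : Fin 6, δ0 p + δ0 q = w ∧ polar (W c p) (W c q) ≠ 0)),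
      ((if δ0 0 + δ0 0 = w ∧ polar (W c 5) (W c 5) ≠ 0 then 2 else if (∃ q : Fin 6, q ≠ 5 ∧ δ0 5 + δ0 q = w ∧ polar (W c 5) (W c q) ≠ 0) then 1 else 0) + 1)) →
    (∀ c c' : Fin C, c < c' → ∀ p q p' q' : Fin 6,
      polar (W c p) (W c q) ≠ 0 → polar (W c' p') (W c' q') ≠ 0 → δ0 p + δ0 q ≤ δ0 p' + δ0 q') →
    (∑ c : Fin C, ((((univ : Finset (Fin 6 × Fin 6)).image (fun pq => δ0 pq.1 + δ0 pq.2)).filter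
        (fun w => (∃ p q : Fin 6, δ0 p + δ0 q = w ∧ polar (W c p) (W c q) ≠ 0))).card - 1) = 14) →
    (∀ w ∈ ((univ : Finset (Fin 6 × Fin 6)).image (fun pq => δ0 pq.1 + δ0 pq.2)),
      (∑ c : Fin C, if (∃ p q : Fin 6, δ0 p + δ0 q = w ∧ polar (W c p) (W c q) ≠ 0)
        then (if δ0 0 + δ0 0 = w ∧ polar (W c 5) (W c 5) ≠ 0 then 2 else if (∃ q : Fin 6, q ≠ 5 ∧ δ0 5 + δ0 q = w ∧ polar (W c 5) (W c q) ≠ 0) then 1 else 0) else 0)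
      = (if w = δ0 0 + δ0 0 then 3 else if (∃ q : Fin 6, q ≠ 0 ∧ q ≠ 5 ∧ w = δ0 0 + δ0 q) then 2 else 1) - 1) →
    2 ≤ C → False

-- OPEN residual (hypothesis only; never asserted)
open Finset Filter in
/-- (rev 6) `NoTightChain26NC` — the NULL-COLLAPSED tight-chain residual: W2 door-p1 g15 #33's hypothesis `hchain` of
`weylFaces_generic_of_confluentDoor_of_noTightChainNC`, BYTE-EXACT from the tree file = `NoTightChain26`'s binder plus the NULL-COLLAPSE premise(s) inserted before
`2 ≤ C → False`: in every cluster, two letters dead on the diagonal with a dead mutual pairing and alive witnesses pair dead IDENTICALLY with every third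
letter, and such a pair of limit letters is proportional (W2 #32 `polar_eq_zero_iff_of_null_collapse` / the tree's `exists_smul_of_polar_eq_zero`).  A prover of this residual may assume it; its combinatorial envelope is the post-collapse survivor set. -/
def NoTightChain26NC : Prop :=
∀ (δs : ℕ → Fin 6 → ℝ) (δ0 : Fin 6 → ℝ),
    (∀ l, Tendsto (fun ν => δs ν l) atTop (𝓝 (δ0 l))) → δ0 5 = δ0 0 →
    (∀ a b c d : Fin 5, δ0 a.castSucc + δ0 b.castSucc = δ0 c.castSucc + δ0 d.castSucc → (a = c ∧ b = d) ∨ (a = d ∧ b = c)) →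
    ∀ (U : ℕ → Fin 6 → Matrix (Fin 2) (Fin 2) ℝ), (∀ ν l, (U ν l).IsSymm) →
    (∀ ν, ∃ t, (∑ l, Real.exp (δs ν l * t) • U ν l).det ≠ 0) →
    ∀ (z : ℕ → Fin 20 → ℝ), (∀ ν, StrictMono (z ν)) → (∀ ν i, (∑ l, Real.exp (δs ν l * z ν i) • U ν l).det = 0) →
    ∀ (φ : ℕ → ℕ), StrictMono φ →
    ∀ (C : ℕ) (m : Fin C → ℕ) (s : Fin C → ℕ → ℝ) (R : ℝ)
      (μ : Fin C → ℕ → ℝ) (Γ : Fin C → Fin 6 → Fin 6 → ℝ) (ε : Fin C → ℝ) (W : Fin C → Fin 6 → Matrix (Fin 2) (Fin 2) ℝ),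
    ∑ c, m c = 20 → (∀ c, 1 ≤ m c) →
    (∀ c c' : Fin C, c < c' → Tendsto (fun k => s c' k - s c k) atTop atTop) →
    (∀ (c : Fin C) (k : ℕ), ∃ x : Fin (m c) → ℝ, StrictMono x ∧ ∀ i, x i ∈ Set.Icc (-R) R ∧
      (∑ l, Real.exp (δs (φ k) l * x i) • (Real.exp (δs (φ k) l * s c k) • U (φ k) l)).det = 0) →
    (∀ c : Fin C,
      (∀ k, 0 < μ c k) ∧
      (∀ k a b, |polar
        (if a = 0 then Real.exp (δs (φ k) 0 * s c k) • U (φ k) 0 + Real.exp (δs (φ k) 5 * s c k) • U (φ k) 5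
          else if a = 5 then (δs (φ k) 5 - δs (φ k) 0) • (Real.exp (δs (φ k) 5 * s c k) • U (φ k) 5)
          else Real.exp (δs (φ k) a * s c k) • U (φ k) a)
        (if b = 0 then Real.exp (δs (φ k) 0 * s c k) • U (φ k) 0 + Real.exp (δs (φ k) 5 * s c k) • U (φ k) 5
          else if b = 5 then (δs (φ k) 5 - δs (φ k) 0) • (Real.exp (δs (φ k) 5 * s c k) • U (φ k) 5)
          else Real.exp (δs (φ k) b * s c k) • U (φ k) b)| ≤ μ c k) ∧
      (∀ a b, Tendsto (fun k => polar
        (if a = 0 then Real.exp (δs (φ k) 0 * s c k) • U (φ k) 0 + Real.exp (δs (φ k) 5 * s c k) • U (φ k) 5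
          else if a = 5 then (δs (φ k) 5 - δs (φ k) 0) • (Real.exp (δs (φ k) 5 * s c k) • U (φ k) 5)
          else Real.exp (δs (φ k) a * s c k) • U (φ k) a)
        (if b = 0 then Real.exp (δs (φ k) 0 * s c k) • U (φ k) 0 + Real.exp (δs (φ k) 5 * s c k) • U (φ k) 5
          else if b = 5 then (δs (φ k) 5 - δs (φ k) 0) • (Real.exp (δs (φ k) 5 * s c k) • U (φ k) 5)
          else Real.exp (δs (φ k) b * s c k) • U (φ k) b) / μ c k) atTop (𝓝 (Γ c a b))) ∧
      (ε c = 1 ∨ ε c = -1) ∧ (∀ l, (W c l).IsSymm) ∧ (∀ a b, Γ c a b = ε c * polar (W c a) (W c b)) ∧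
      (∃ t, ((Real.exp (δ0 0 * t)) • (W c 0 + t • W c 5)
        + ∑ k : Fin 4, (Real.exp (δ0 k.succ.castSucc * t)) • W c k.succ.castSucc).det ≠ 0) ∧
      ∀ (n : ℕ) (ψ : ℕ → ℕ), StrictMono ψ → ∀ (ts : ℕ → ℝ) (t₀ : ℝ), Tendsto ts atTop (𝓝 t₀) →
        Tendsto (fun k => iteratedDeriv n
            (fun t => ε c * (μ c (ψ k))⁻¹ *
              (∑ l, Real.exp (δs (φ (ψ k)) l * t) • (Real.exp (δs (φ (ψ k)) l * s c (ψ k)) • U (φ (ψ k)) l)).det) (ts k))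
          atTop (𝓝 (iteratedDeriv n
            (fun t => ((Real.exp (δ0 0 * t)) • (W c 0 + t • W c 5)
              + ∑ k : Fin 4, (Real.exp (δ0 k.succ.castSucc * t)) • W c k.succ.castSucc).det) t₀))) →
    ((univ : Finset (Fin 6 × Fin 6)).image (fun pq => δ0 pq.1 + δ0 pq.2)).card = 15 →
    (∀ c : Fin C, m c + 1 = ∑ w ∈ ((univ : Finset (Fin 6 × Fin 6)).image (fun pq => δ0 pq.1 + δ0 pq.2)).filter
        (fun w => (∃ p q : Fin 6, δ0 p + δ0 q = w ∧ polar (W c p) (W c q) ≠ 0)),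
      ((if δ0 0 + δ0 0 = w ∧ polar (W c 5) (W c 5) ≠ 0 then 2 else if (∃ q : Fin 6, q ≠ 5 ∧ δ0 5 + δ0 q = w ∧ polar (W c 5) (W c q) ≠ 0) then 1 else 0) + 1)) →
    (∀ c c' : Fin C, c < c' → ∀ p q p' q' : Fin 6,
      polar (W c p) (W c q) ≠ 0 → polar (W c' p') (W c' q') ≠ 0 → δ0 p + δ0 q ≤ δ0 p' + δ0 q') →
    (∑ c : Fin C, ((((univ : Finset (Fin 6 × Fin 6)).image (fun pq => δ0 pq.1 + δ0 pq.2)).filter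
        (fun w => (∃ p q : Fin 6, δ0 p + δ0 q = w ∧ polar (W c p) (W c q) ≠ 0))).card - 1) = 14) →
    (∀ w ∈ ((univ : Finset (Fin 6 × Fin 6)).image (fun pq => δ0 pq.1 + δ0 pq.2)),
      (∑ c : Fin C, if (∃ p q : Fin 6, δ0 p + δ0 q = w ∧ polar (W c p) (W c q) ≠ 0)
        then (if δ0 0 + δ0 0 = w ∧ polar (W c 5) (W c 5) ≠ 0 then 2 else if (∃ q : Fin 6, q ≠ 5 ∧ δ0 5 + δ0 q = w ∧ polar (W c 5) (W c q) ≠ 0) then 1 else 0) else 0)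
      = (if w = δ0 0 + δ0 0 then 3 else if (∃ q : Fin 6, q ≠ 0 ∧ q ≠ 5 ∧ w = δ0 0 + δ0 q) then 2 else 1) - 1) →
    -- NULL-COLLAPSE CONSISTENCY (W2 #32): in every cluster, two letters dead on the diagonal with a dead mutual pairing and alive witnesses
    -- pair dead IDENTICALLY with every third letter
    (∀ (c : Fin C) (p q r : Fin 6),
      polar (W c p) (W c p) = 0 → polar (W c q) (W c q) = 0 → polar (W c p) (W c q) = 0 →
      (∃ x : Fin 6, polar (W c p) (W c x) ≠ 0) → (∃ y : Fin 6, polar (W c q) (W c y) ≠ 0) →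
      (polar (W c r) (W c p) = 0 ↔ polar (W c r) (W c q) = 0)) →
    -- NULL COLLAPSE ITSELF: such a pair of limit letters is PROPORTIONAL (the tree's `exists_smul_of_polar_eq_zero`)
    (∀ (c : Fin C) (p q : Fin 6),
      polar (W c p) (W c p) = 0 → polar (W c q) (W c q) = 0 → polar (W c p) (W c q) = 0 →
      (∃ y : Fin 6, polar (W c q) (W c y) ≠ 0) → ∃ lam : ℝ, W c p = lam • W c q) →
    2 ≤ C → False

/-- (rev 5) TARGET SHAPE OF RECORD for (W) at generic faces (desk R2843 (B)): the confluent door AND the tight-chain residual close (W) on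
generic faces. -/
def Stmt.weylFaces_generic_of_confluentDoor_of_noTightChain : Prop :=
  ConfluentDoor26 → NoTightChain26 → Stmt.weylFaces_generic

/-- (rev 5) KERNEL LINK: W2 #27 `weylFaces_generic_of_confluentDoor_of_noTightChain` (namespace `…Theorems.LacunarySymmetroidMatrixDescartes.WallBubbling`)
proves the two-input target shape for THIS file's definitions — `ConfluentDoor26`, `confluentDet`, `polar`, `SortedSimplex`, `TwentyLocus`,
`IsGenericWeylFace` are verbatim copies of the Theorems-side ones and unfold definitionally. -/
theorem weylFaces_generic_of_doors : Stmt.weylFaces_generic_of_confluentDoor_of_noTightChain :=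
  fun hd hc δ hδ i j hg =>
    Summit.ValiantsHypothesis.ValiantsHypothesis.Theorems.LacunarySymmetroidMatrixDescartes.WallBubbling.weylFaces_generic_of_confluentDoor_of_noTightChain
      hd hc δ hδ i j hg

/-- The split of (W) into its generic and deep parts — pure logic, kernel-checked. -/
theorem weylFaces_of_generic_of_deep (hg : Stmt.weylFaces_generic) (hd : Stmt.weylFaces_deep) :
    Stmt.stub_weylFaces := by
  intro δ hδ hcl hW
  by_cases h : ∃ i j : Fin 6, IsGenericWeylFace δ i j
  · obtain ⟨i, j, hij⟩ := h
    exact hg δ hδ i j hij hcl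
  · simp only [not_exists] at h
    exact hd δ hδ hW h hcl

/-- Hence, on the confluent door, (W) reduces to its deep part plus W2's reduction #4 — the bookkeeping form the line lead will cite. -/
theorem weylFaces_of_confluentDoor (hred : Stmt.weylFaces_generic_of_confluentDoor) (hdoor : ConfluentDoor26)
    (hd : Stmt.weylFaces_deep) : Stmt.stub_weylFaces :=
  weylFaces_of_generic_of_deep (hred hdoor) hd

/-- (rev 5) Hence **(W) ⇐ ConfluentDoor26 ∧ NoTightChain26 ∧ (W_deep)** — kernel bookkeeping over W2 #27; the form the line lead cites from rev 5 on. -/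
theorem weylFaces_of_doors (hdoor : ConfluentDoor26) (hnc : NoTightChain26) (hd : Stmt.weylFaces_deep) : Stmt.stub_weylFaces :=
  weylFaces_of_generic_of_deep (weylFaces_generic_of_doors hdoor hnc) hd

/-- (rev 6) TARGET SHAPE with the null-collapsed residual. -/
def Stmt.weylFaces_generic_of_confluentDoor_of_noTightChainNC : Prop :=
  ConfluentDoor26 → NoTightChain26NC → Stmt.weylFaces_generic

/-- (rev 6) KERNEL LINK: W2 #33 `weylFaces_generic_of_confluentDoor_of_noTightChainNC` proves the NC target shape for THIS file's definitions
(verbatim copies, unfolding definitionally). -/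
theorem weylFaces_generic_of_doorsNC : Stmt.weylFaces_generic_of_confluentDoor_of_noTightChainNC :=
  fun hd hc δ hδ i j hg =>
    Summit.ValiantsHypothesis.ValiantsHypothesis.Theorems.LacunarySymmetroidMatrixDescartes.WallBubbling.weylFaces_generic_of_confluentDoor_of_noTightChainNC
      hd hc δ hδ i j hg

/-- (rev 6) the NC residual is WEAKER as a hypothesis-set statement: `NoTightChain26` implies it (drop the extra premise). -/
theorem noTightChain26NC_of_noTightChain26 (h : NoTightChain26) : NoTightChain26NC := by
  unfold NoTightChain26 at h
  intro δs δ0 hδ h05 hsid U hU hne z hz hroot φ hφ C m s R μ Γ ε W hm20 hm1 hdrift hzeros hpkg hV15 hLP hmono hsum14 hsplit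
  intros   -- the extra null-collapse premise(s) of the NC residual and `2 ≤ C`
  exact h δs δ0 hδ h05 hsid U hU hne z hz hroot φ hφ C m s R μ Γ ε W hm20 hm1 hdrift hzeros hpkg hV15 hLP hmono hsum14 hsplit ‹2 ≤ C›

/-- (rev 6) Hence **(W) ⇐ ConfluentDoor26 ∧ NoTightChain26NC ∧ (W_deep)** — kernel bookkeeping over W2 #33; the form the line lead cites from rev 6 on. -/
theorem weylFaces_of_doorsNC (hdoor : ConfluentDoor26) (hnc : NoTightChain26NC) (hd : Stmt.weylFaces_deep) : Stmt.stub_weylFaces :=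
  weylFaces_of_generic_of_deep (weylFaces_generic_of_doorsNC hdoor hnc) hd


/-! ## rev 7 — W1 #42 (one Weyl pair on a wall, closed outright) and #44 ((W_deepVal) stratified) linked in the kernel -/

/-- (rev 7) ONE-PAIR predicate — W1 #42's `honePair`: every coincidence of two letters of `δ` is the pair `{i, j}`. -/
def IsOnePairWall (δ : Fin 6 → ℝ) : Prop :=
  ∀ i j k l : Fin 6, i ≠ j → δ i = δ j → k ≠ l → δ k = δ l → k = i ∨ k = j

/-- (rev 7) (W_wall), ONE-PAIR PART: a point of the wall stratum whose only coincidence of letters is one pair. PROVED (next decl). -/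
def Stmt.weylFaces_wall_onePair : Prop :=
  ∀ δ ∈ SortedSimplex, HasWeylCoincidence δ → ¬ HasMixedCoincidence δ → ¬ IsValueGeneric δ → IsOnePairWall δ →
    δ ∉ closure TwentyLocus

/-- (rev 7) KERNEL LINK, UNCONDITIONAL: W1 #42 `not_mem_closure_twentyLocus_onePairWall` proves the one-pair part of (W_wall) for THIS file's
definitions (verbatim copies, unfolding definitionally).  Door-free, no tight-chain residual. -/
theorem weylFaces_wall_onePair_holds : Stmt.weylFaces_wall_onePair :=
  fun δ hδ hW hM hV h1 =>
    Summit.ValiantsHypothesis.ValiantsHypothesis.Theorems.LacunarySymmetroidMatrixDescartes.WallBubbling.not_mem_closure_twentyLocus_onePairWall δ hδ hW hM hV h1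

/-- (rev 7) (W_wall), MULTI-PAIR PART (at least two Weyl pairs on a disjoint-type wall: the (c1)/(c2)/(c3) strata; single-cluster branch W1 #28,
multi-cluster branch needs two-dslope rungs) — OPEN. -/
def Stmt.weylFaces_wall_multiPair : Prop :=
  ∀ δ ∈ SortedSimplex, HasWeylCoincidence δ → ¬ HasMixedCoincidence δ → ¬ IsValueGeneric δ → ¬ IsOnePairWall δ →
    δ ∉ closure TwentyLocus

/-- (rev 7) (W_wall) ⟸ its multi-pair part — the one-pair part is W1 #42; pure logic. -/
theorem weylFaces_wall_of_multiPair (h : Stmt.weylFaces_wall_multiPair) : Stmt.weylFaces_wall := by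
  intro δ hδ hW hM hV
  by_cases h1 : IsOnePairWall δ
  · exact weylFaces_wall_onePair_holds δ hδ hW hM hV h1
  · exact h δ hδ hW hM hV h1

open Filter in
/-- (rev 7) W1 #44's hypothesis `hVG2` BYTE-EXACT: no chain of genuine `(2,6)` pencils with twenty log-zeros converges to a VALUE-GENERIC
TWO-WEYL-PAIR point (`δ0 5 = δ0 0`, `δ0 4 = δ0 1`, normal position).  OPEN (single-cluster branch: W1 #28). -/
def ValueGenericTwoPairChain26 : Prop :=
  ∀ (δs : ℕ → Fin 6 → ℝ) (δ0 : Fin 6 → ℝ), (∀ l, Tendsto (fun ν => δs ν l) atTop (𝓝 (δ0 l))) →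
      δ0 5 = δ0 0 → δ0 4 = δ0 1 →
      (∀ a b c d : Fin 4, δ0 a.castSucc.castSucc + δ0 b.castSucc.castSucc = δ0 c.castSucc.castSucc + δ0 d.castSucc.castSucc →
        (a = c ∧ b = d) ∨ (a = d ∧ b = c)) →
      ∀ (U : ℕ → Fin 6 → Matrix (Fin 2) (Fin 2) ℝ), (∀ ν l, (U ν l).IsSymm) →
      (∀ ν, ∃ t, (∑ l, Real.exp (δs ν l * t) • U ν l).det ≠ 0) →
      ∀ (z : ℕ → Fin 20 → ℝ), (∀ ν, StrictMono (z ν)) → (∀ ν i, (∑ l, Real.exp (δs ν l * z ν i) • U ν l).det = 0) → False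

open Filter in
/-- (rev 7) W1 #44's hypothesis `hVG3` BYTE-EXACT: the same at a VALUE-GENERIC THREE-PAIR point (`δ0 3 = δ0 2` too).  OPEN (single-cluster
branch: W1 #33). -/
def ValueGenericThreePairChain26 : Prop :=
  ∀ (δs : ℕ → Fin 6 → ℝ) (δ0 : Fin 6 → ℝ), (∀ l, Tendsto (fun ν => δs ν l) atTop (𝓝 (δ0 l))) →
      δ0 5 = δ0 0 → δ0 4 = δ0 1 → δ0 3 = δ0 2 →
      (∀ a b c e : Fin 3, δ0 a.castSucc.castSucc.castSucc + δ0 b.castSucc.castSucc.castSucc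
          = δ0 c.castSucc.castSucc.castSucc + δ0 e.castSucc.castSucc.castSucc → (a = c ∧ b = e) ∨ (a = e ∧ b = c)) →
      ∀ (U : ℕ → Fin 6 → Matrix (Fin 2) (Fin 2) ℝ), (∀ ν l, (U ν l).IsSymm) →
      (∀ ν, ∃ t, (∑ l, Real.exp (δs ν l * t) • U ν l).det ≠ 0) →
      ∀ (z : ℕ → Fin 20 → ℝ), (∀ ν, StrictMono (z ν)) → (∀ ν i, (∑ l, Real.exp (δs ν l * z ν i) • U ν l).det = 0) → False

/-- (rev 7) W1 #44's hypothesis `hT` BYTE-EXACT: a value-generic point of the sorted simplex with a TRIPLE `δ_i = δ_j = δ_k` is not a limit of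
twenties (closure currency; triple frame, cancelling Gram pattern `2E_ac − E_bb` realisable).  OPEN, untouched. -/
def TripleStratum26 : Prop :=
  ∀ δ ∈ SortedSimplex, (∃ i j k : Fin 6, i ≠ j ∧ i ≠ k ∧ j ≠ k ∧ δ i = δ j ∧ δ i = δ k) →
      (∀ a b c d : Fin 6, δ a + δ b = δ c + δ d → (δ a = δ c ∧ δ b = δ d) ∨ (δ a = δ d ∧ δ b = δ c)) →
      δ ∉ closure TwentyLocus

/-- (rev 7) KERNEL LINK: W1 #44 `weylFaces_deepVal_of_chains` stratifies (W_deepVal) for THIS file's definitions: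
**(W_deepVal) ⟸ ValueGenericTwoPairChain26 ∧ ValueGenericThreePairChain26 ∧ TripleStratum26**. -/
theorem weylFaces_deepVal_of_chains' (h2 : ValueGenericTwoPairChain26) (h3 : ValueGenericThreePairChain26)
    (hT : TripleStratum26) : Stmt.weylFaces_deepVal :=
  fun δ hδ hW hV hng =>
    Summit.ValiantsHypothesis.ValiantsHypothesis.Theorems.LacunarySymmetroidMatrixDescartes.WallBubbling.weylFaces_deepVal_of_chains h2 h3 hT δ hδ hW hV hng

/-- (rev 7) THE (W) LEDGER after rev 7, kernel bookkeeping: **(W) ⟸ ConfluentDoor26 ∧ NoTightChain26NC ∧ (M) ∧ ValueGenericTwoPairChain26 ∧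
ValueGenericThreePairChain26 ∧ TripleStratum26 ∧ (W_wall multi-pair)** — all seven OPEN, typed, never asserted. -/
theorem weylFaces_of_doorsNC_strata (hdoor : ConfluentDoor26) (hnc : NoTightChain26NC) (hM : Stmt.stub_mixedWalls)
    (h2 : ValueGenericTwoPairChain26) (h3 : ValueGenericThreePairChain26) (hT : TripleStratum26)
    (hw : Stmt.weylFaces_wall_multiPair) : Stmt.stub_weylFaces :=
  weylFaces_of_doorsNC hdoor hnc
    (weylFaces_deep_of_split hM (weylFaces_deepVal_of_chains' h2 h3 hT) (weylFaces_wall_of_multiPair hw))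

open Filter in
open Summit.ValiantsHypothesis.ValiantsHypothesis.Theorems.LacunarySymmetroidMatrixDescartes.WallBubbling.Bubbling (polar) in
/-- (rev 8) MIXED-CLASS RULE «TOP» for the 4-member class `δ₀+δ₁ = {(0,1),(0,4),(5,1),(5,4)}` at a two-Weyl-pair point — **FACE FORM** (binder decision of record, desk R2981 (ii)): quantified over `δ0` ON THE FACE `δ0 5 = δ0 0`, `δ0 4 = δ0 1`, then BYTE-EXACT the binder `hMixTop` of W1 #52 `twoPair_noTwenties_of_mixedRules` (stated there at a face `δ0`).  The `δ0`-free form used as hypothesis in W1 #53 is FALSE off the face (crit-2 g5's two-scale witness `mixtop_witness.lean` 3879ae8c98f06a84) and is NOT linked.  OPEN, typed, never asserted; by crit-2 g5's face domination calculus (`mix_rules_face_domination.md` f13ad36479d39fd7 §3: ψ = (1 − e^{−εL})/ε → ∞) plausibly a LEMMA for the W1 successor, not a target to book.  No-junk: at the face the premises are satisfiable (paper instance: U = (−E₁₁/ε_ν, −E₂₂/ε′_ν, 0, 0, E₂₂/ε′_ν, E₁₁/ε_ν), ε_ν = δs ν 5 − δs ν 0, ε′_ν = δs ν 4 − δs ν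 1, L ν = ν, μ ≡ 1/2: Γ 5 4 = 1; second-scale polars dominated by (0,1)′, so Γ′ 5 4 = Γ′ 0 4 = Γ′ 5 1 = 0 as the rule predicts). -/
def MixTop26 : Prop :=
  ∀ (δ0 : Fin 6 → ℝ), δ0 5 = δ0 0 → δ0 4 = δ0 1 →
    ∀ (δs : ℕ → Fin 6 → ℝ), (∀ l, Tendsto (fun ν => δs ν l) atTop (𝓝 (δ0 l))) →
      ∀ (U : ℕ → Fin 6 → Matrix (Fin 2) (Fin 2) ℝ) (L : ℕ → ℝ), Tendsto L atTop atTop →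
      ∀ (μ μ' : ℕ → ℝ), (∀ ν, 0 < μ ν) → (∀ ν, 0 < μ' ν) →
      (∀ ν a b, |polar (if a = 0 then U ν 0 + U ν 5 else if a = 1 then U ν 1 + U ν 4
          else if a = 4 then (δs ν 4 - δs ν 1) • U ν 4 else if a = 5 then (δs ν 5 - δs ν 0) • U ν 5 else U ν a)
        (if b = 0 then U ν 0 + U ν 5 else if b = 1 then U ν 1 + U ν 4
          else if b = 4 then (δs ν 4 - δs ν 1) • U ν 4 else if b = 5 then (δs ν 5 - δs ν 0) • U ν 5 else U ν b)| ≤ μ ν) →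
      (∀ ν a b, |polar (if a = 0 then Real.exp (δs ν 0 * L ν) • U ν 0 + Real.exp (δs ν 5 * L ν) • U ν 5
          else if a = 1 then Real.exp (δs ν 1 * L ν) • U ν 1 + Real.exp (δs ν 4 * L ν) • U ν 4
          else if a = 4 then (δs ν 4 - δs ν 1) • (Real.exp (δs ν 4 * L ν) • U ν 4)
          else if a = 5 then (δs ν 5 - δs ν 0) • (Real.exp (δs ν 5 * L ν) • U ν 5) else Real.exp (δs ν a * L ν) • U ν a)
        (if b = 0 then Real.exp (δs ν 0 * L ν) • U ν 0 + Real.exp (δs ν 5 * L ν) • U ν 5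
          else if b = 1 then Real.exp (δs ν 1 * L ν) • U ν 1 + Real.exp (δs ν 4 * L ν) • U ν 4
          else if b = 4 then (δs ν 4 - δs ν 1) • (Real.exp (δs ν 4 * L ν) • U ν 4)
          else if b = 5 then (δs ν 5 - δs ν 0) • (Real.exp (δs ν 5 * L ν) • U ν 5) else Real.exp (δs ν b * L ν) • U ν b)| ≤ μ' ν) →
      ∀ (Γ Γ' : Fin 6 → Fin 6 → ℝ),
      (∀ a b, Tendsto (fun ν => polar (if a = 0 then U ν 0 + U ν 5 else if a = 1 then U ν 1 + U ν 4
          else if a = 4 then (δs ν 4 - δs ν 1) • U ν 4 else if a = 5 then (δs ν 5 - δs ν 0) • U ν 5 else U ν a)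
        (if b = 0 then U ν 0 + U ν 5 else if b = 1 then U ν 1 + U ν 4
          else if b = 4 then (δs ν 4 - δs ν 1) • U ν 4 else if b = 5 then (δs ν 5 - δs ν 0) • U ν 5 else U ν b) / μ ν) atTop (𝓝 (Γ a b))) →
      (∀ a b, Tendsto (fun ν => polar (if a = 0 then Real.exp (δs ν 0 * L ν) • U ν 0 + Real.exp (δs ν 5 * L ν) • U ν 5
          else if a = 1 then Real.exp (δs ν 1 * L ν) • U ν 1 + Real.exp (δs ν 4 * L ν) • U ν 4
          else if a = 4 then (δs ν 4 - δs ν 1) • (Real.exp (δs ν 4 * L ν) • U ν 4)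
          else if a = 5 then (δs ν 5 - δs ν 0) • (Real.exp (δs ν 5 * L ν) • U ν 5) else Real.exp (δs ν a * L ν) • U ν a)
        (if b = 0 then Real.exp (δs ν 0 * L ν) • U ν 0 + Real.exp (δs ν 5 * L ν) • U ν 5
          else if b = 1 then Real.exp (δs ν 1 * L ν) • U ν 1 + Real.exp (δs ν 4 * L ν) • U ν 4
          else if b = 4 then (δs ν 4 - δs ν 1) • (Real.exp (δs ν 4 * L ν) • U ν 4)
          else if b = 5 then (δs ν 5 - δs ν 0) • (Real.exp (δs ν 5 * L ν) • U ν 5) else Real.exp (δs ν b * L ν) • U ν b) / μ' ν) atTop (𝓝 (Γ' a b))) →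
      Γ 5 4 ≠ 0 → Γ' 5 4 = 0 ∧ Γ' 0 4 = 0 ∧ Γ' 5 1 = 0

/-- (rev 10) KERNEL LINK, UNCONDITIONAL: W1 door-p2 g14 #54 `…WallBubblingMixTop.mixTop_face` (p698220 @9e9db086175b) proves rule «TOP» for
THIS file's `MixTop26` — by name, the verbatim statement unfolding definitionally.  First of the three mixed-class rules to become kernel. -/
theorem MixTop26_holds : MixTop26 :=
  fun δ0 h50 h41 =>
    Summit.ValiantsHypothesis.ValiantsHypothesis.Theorems.LacunarySymmetroidMatrixDescartes.WallBubbling.mixTop_face δ0 h50 h41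

open Filter in
open Summit.ValiantsHypothesis.ValiantsHypothesis.Theorems.LacunarySymmetroidMatrixDescartes.WallBubbling.Bubbling (polar) in
/-- (rev 8) MIXED-CLASS RULE «MID», FACE FORM — `δ0` on the face, then BYTE-EXACT the binder `hMixMid` of W1 #52.  OPEN, typed, never asserted; crit-2 g5's calculus §4 (|P₀₄|/|P₀₁| ≈ 1/φ′ → 0) suggests it is a lemma at the face.  No-junk: premise `Γ 0 4 ≠ 0` satisfiable at the face (U₀ = −E₁₁/ε_ν + E₁₁ in the instance above gives Γ 0 4 = 1). -/
def MixMid26 : Prop :=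
  ∀ (δ0 : Fin 6 → ℝ), δ0 5 = δ0 0 → δ0 4 = δ0 1 →
    ∀ (δs : ℕ → Fin 6 → ℝ), (∀ l, Tendsto (fun ν => δs ν l) atTop (𝓝 (δ0 l))) →
      ∀ (U : ℕ → Fin 6 → Matrix (Fin 2) (Fin 2) ℝ) (L : ℕ → ℝ), Tendsto L atTop atTop →
      ∀ (μ μ' : ℕ → ℝ), (∀ ν, 0 < μ ν) → (∀ ν, 0 < μ' ν) →
      (∀ ν a b, |polar (if a = 0 then U ν 0 + U ν 5 else if a = 1 then U ν 1 + U ν 4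
          else if a = 4 then (δs ν 4 - δs ν 1) • U ν 4 else if a = 5 then (δs ν 5 - δs ν 0) • U ν 5 else U ν a)
        (if b = 0 then U ν 0 + U ν 5 else if b = 1 then U ν 1 + U ν 4
          else if b = 4 then (δs ν 4 - δs ν 1) • U ν 4 else if b = 5 then (δs ν 5 - δs ν 0) • U ν 5 else U ν b)| ≤ μ ν) →
      (∀ ν a b, |polar (if a = 0 then Real.exp (δs ν 0 * L ν) • U ν 0 + Real.exp (δs ν 5 * L ν) • U ν 5
          else if a = 1 then Real.exp (δs ν 1 * L ν) • U ν 1 + Real.exp (δs ν 4 * L ν) • U ν 4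
          else if a = 4 then (δs ν 4 - δs ν 1) • (Real.exp (δs ν 4 * L ν) • U ν 4)
          else if a = 5 then (δs ν 5 - δs ν 0) • (Real.exp (δs ν 5 * L ν) • U ν 5) else Real.exp (δs ν a * L ν) • U ν a)
        (if b = 0 then Real.exp (δs ν 0 * L ν) • U ν 0 + Real.exp (δs ν 5 * L ν) • U ν 5
          else if b = 1 then Real.exp (δs ν 1 * L ν) • U ν 1 + Real.exp (δs ν 4 * L ν) • U ν 4
          else if b = 4 then (δs ν 4 - δs ν 1) • (Real.exp (δs ν 4 * L ν) • U ν 4)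
          else if b = 5 then (δs ν 5 - δs ν 0) • (Real.exp (δs ν 5 * L ν) • U ν 5) else Real.exp (δs ν b * L ν) • U ν b)| ≤ μ' ν) →
      ∀ (Γ Γ' : Fin 6 → Fin 6 → ℝ),
      (∀ a b, Tendsto (fun ν => polar (if a = 0 then U ν 0 + U ν 5 else if a = 1 then U ν 1 + U ν 4
          else if a = 4 then (δs ν 4 - δs ν 1) • U ν 4 else if a = 5 then (δs ν 5 - δs ν 0) • U ν 5 else U ν a)
        (if b = 0 then U ν 0 + U ν 5 else if b = 1 then U ν 1 + U ν 4
          else if b = 4 then (δs ν 4 - δs ν 1) • U ν 4 else if b = 5 then (δs ν 5 - δs ν 0) • U ν 5 else U ν b) / μ ν) atTop (𝓝 (Γ a b))) →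
      (∀ a b, Tendsto (fun ν => polar (if a = 0 then Real.exp (δs ν 0 * L ν) • U ν 0 + Real.exp (δs ν 5 * L ν) • U ν 5
          else if a = 1 then Real.exp (δs ν 1 * L ν) • U ν 1 + Real.exp (δs ν 4 * L ν) • U ν 4
          else if a = 4 then (δs ν 4 - δs ν 1) • (Real.exp (δs ν 4 * L ν) • U ν 4)
          else if a = 5 then (δs ν 5 - δs ν 0) • (Real.exp (δs ν 5 * L ν) • U ν 5) else Real.exp (δs ν a * L ν) • U ν a)
        (if b = 0 then Real.exp (δs ν 0 * L ν) • U ν 0 + Real.exp (δs ν 5 * L ν) • U ν 5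
          else if b = 1 then Real.exp (δs ν 1 * L ν) • U ν 1 + Real.exp (δs ν 4 * L ν) • U ν 4
          else if b = 4 then (δs ν 4 - δs ν 1) • (Real.exp (δs ν 4 * L ν) • U ν 4)
          else if b = 5 then (δs ν 5 - δs ν 0) • (Real.exp (δs ν 5 * L ν) • U ν 5) else Real.exp (δs ν b * L ν) • U ν b) / μ' ν) atTop (𝓝 (Γ' a b))) →
      (Γ 0 4 ≠ 0 ∨ Γ 5 1 ≠ 0) → Γ' 5 4 = 0

open Filter in
open Summit.ValiantsHypothesis.ValiantsHypothesis.Theorems.LacunarySymmetroidMatrixDescartes.WallBubbling.Bubbling (polar) in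
/-- (rev 8; **rev 9: FALSE AS TYPED** — crit-5 g4 kernel `Crit5MixThree.hMixThree_false` 8659179a23384541 / `not_mixThree26L` 07b279c3987f6a57, isotropic-plane witness over ALL matrices at every face point; kept verbatim as the settled negative edge; the repaired rule is `MixThree26'` below) MIXED-CLASS RULE «THREE-SCALE», FACE FORM — `δ0` on the face, then BYTE-EXACT the binder `hMixThree` of W1 #52 (degree-1 members alive at three scales ⇒ `False`).  Typed, never asserted; REFUTED as typed (U unrestricted). -/
def MixThree26 : Prop :=
  ∀ (δ0 : Fin 6 → ℝ), δ0 5 = δ0 0 → δ0 4 = δ0 1 →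
    ∀ (δs : ℕ → Fin 6 → ℝ), (∀ l, Tendsto (fun ν => δs ν l) atTop (𝓝 (δ0 l))) →
      ∀ (U : ℕ → Fin 6 → Matrix (Fin 2) (Fin 2) ℝ) (L₁ L₂ : ℕ → ℝ), Tendsto L₁ atTop atTop → Tendsto L₂ atTop atTop →
      ∀ (μ₁ μ₂ μ₃ : ℕ → ℝ), (∀ ν, 0 < μ₁ ν) → (∀ ν, 0 < μ₂ ν) → (∀ ν, 0 < μ₃ ν) →
      (∀ ν a b, |polar (if a = 0 then U ν 0 + U ν 5 else if a = 1 then U ν 1 + U ν 4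
          else if a = 4 then (δs ν 4 - δs ν 1) • U ν 4 else if a = 5 then (δs ν 5 - δs ν 0) • U ν 5 else U ν a)
        (if b = 0 then U ν 0 + U ν 5 else if b = 1 then U ν 1 + U ν 4
          else if b = 4 then (δs ν 4 - δs ν 1) • U ν 4 else if b = 5 then (δs ν 5 - δs ν 0) • U ν 5 else U ν b)| ≤ μ₁ ν) →
      (∀ ν a b, |polar (if a = 0 then Real.exp (δs ν 0 * L₁ ν) • U ν 0 + Real.exp (δs ν 5 * L₁ ν) • U ν 5
          else if a = 1 then Real.exp (δs ν 1 * L₁ ν) • U ν 1 + Real.exp (δs ν 4 * L₁ ν) • U ν 4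
          else if a = 4 then (δs ν 4 - δs ν 1) • (Real.exp (δs ν 4 * L₁ ν) • U ν 4)
          else if a = 5 then (δs ν 5 - δs ν 0) • (Real.exp (δs ν 5 * L₁ ν) • U ν 5) else Real.exp (δs ν a * L₁ ν) • U ν a)
        (if b = 0 then Real.exp (δs ν 0 * L₁ ν) • U ν 0 + Real.exp (δs ν 5 * L₁ ν) • U ν 5
          else if b = 1 then Real.exp (δs ν 1 * L₁ ν) • U ν 1 + Real.exp (δs ν 4 * L₁ ν) • U ν 4
          else if b = 4 then (δs ν 4 - δs ν 1) • (Real.exp (δs ν 4 * L₁ ν) • U ν 4)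
          else if b = 5 then (δs ν 5 - δs ν 0) • (Real.exp (δs ν 5 * L₁ ν) • U ν 5) else Real.exp (δs ν b * L₁ ν) • U ν b)| ≤ μ₂ ν) →
      (∀ ν a b, |polar (if a = 0 then Real.exp (δs ν 0 * (L₁ ν + L₂ ν)) • U ν 0 + Real.exp (δs ν 5 * (L₁ ν + L₂ ν)) • U ν 5
          else if a = 1 then Real.exp (δs ν 1 * (L₁ ν + L₂ ν)) • U ν 1 + Real.exp (δs ν 4 * (L₁ ν + L₂ ν)) • U ν 4
          else if a = 4 then (δs ν 4 - δs ν 1) • (Real.exp (δs ν 4 * (L₁ ν + L₂ ν)) • U ν 4)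
          else if a = 5 then (δs ν 5 - δs ν 0) • (Real.exp (δs ν 5 * (L₁ ν + L₂ ν)) • U ν 5) else Real.exp (δs ν a * (L₁ ν + L₂ ν)) • U ν a)
        (if b = 0 then Real.exp (δs ν 0 * (L₁ ν + L₂ ν)) • U ν 0 + Real.exp (δs ν 5 * (L₁ ν + L₂ ν)) • U ν 5
          else if b = 1 then Real.exp (δs ν 1 * (L₁ ν + L₂ ν)) • U ν 1 + Real.exp (δs ν 4 * (L₁ ν + L₂ ν)) • U ν 4
          else if b = 4 then (δs ν 4 - δs ν 1) • (Real.exp (δs ν 4 * (L₁ ν + L₂ ν)) • U ν 4)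
          else if b = 5 then (δs ν 5 - δs ν 0) • (Real.exp (δs ν 5 * (L₁ ν + L₂ ν)) • U ν 5) else Real.exp (δs ν b * (L₁ ν + L₂ ν)) • U ν b)| ≤ μ₃ ν) →
      ∀ (Γ₁ Γ₂ Γ₃ : Fin 6 → Fin 6 → ℝ),
      (∀ a b, Tendsto (fun ν => polar (if a = 0 then U ν 0 + U ν 5 else if a = 1 then U ν 1 + U ν 4
          else if a = 4 then (δs ν 4 - δs ν 1) • U ν 4 else if a = 5 then (δs ν 5 - δs ν 0) • U ν 5 else U ν a)
        (if b = 0 then U ν 0 + U ν 5 else if b = 1 then U ν 1 + U ν 4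
          else if b = 4 then (δs ν 4 - δs ν 1) • U ν 4 else if b = 5 then (δs ν 5 - δs ν 0) • U ν 5 else U ν b) / μ₁ ν) atTop (𝓝 (Γ₁ a b))) →
      (∀ a b, Tendsto (fun ν => polar (if a = 0 then Real.exp (δs ν 0 * L₁ ν) • U ν 0 + Real.exp (δs ν 5 * L₁ ν) • U ν 5
          else if a = 1 then Real.exp (δs ν 1 * L₁ ν) • U ν 1 + Real.exp (δs ν 4 * L₁ ν) • U ν 4
          else if a = 4 then (δs ν 4 - δs ν 1) • (Real.exp (δs ν 4 * L₁ ν) • U ν 4)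
          else if a = 5 then (δs ν 5 - δs ν 0) • (Real.exp (δs ν 5 * L₁ ν) • U ν 5) else Real.exp (δs ν a * L₁ ν) • U ν a)
        (if b = 0 then Real.exp (δs ν 0 * L₁ ν) • U ν 0 + Real.exp (δs ν 5 * L₁ ν) • U ν 5
          else if b = 1 then Real.exp (δs ν 1 * L₁ ν) • U ν 1 + Real.exp (δs ν 4 * L₁ ν) • U ν 4
          else if b = 4 then (δs ν 4 - δs ν 1) • (Real.exp (δs ν 4 * L₁ ν) • U ν 4)
          else if b = 5 then (δs ν 5 - δs ν 0) • (Real.exp (δs ν 5 * L₁ ν) • U ν 5) else Real.exp (δs ν b * L₁ ν) • U ν b) / μ₂ ν) atTop (𝓝 (Γ₂ a b))) →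
      (∀ a b, Tendsto (fun ν => polar (if a = 0 then Real.exp (δs ν 0 * (L₁ ν + L₂ ν)) • U ν 0 + Real.exp (δs ν 5 * (L₁ ν + L₂ ν)) • U ν 5
          else if a = 1 then Real.exp (δs ν 1 * (L₁ ν + L₂ ν)) • U ν 1 + Real.exp (δs ν 4 * (L₁ ν + L₂ ν)) • U ν 4
          else if a = 4 then (δs ν 4 - δs ν 1) • (Real.exp (δs ν 4 * (L₁ ν + L₂ ν)) • U ν 4)
          else if a = 5 then (δs ν 5 - δs ν 0) • (Real.exp (δs ν 5 * (L₁ ν + L₂ ν)) • U ν 5) else Real.exp (δs ν a * (L₁ ν + L₂ ν)) • U ν a)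
        (if b = 0 then Real.exp (δs ν 0 * (L₁ ν + L₂ ν)) • U ν 0 + Real.exp (δs ν 5 * (L₁ ν + L₂ ν)) • U ν 5
          else if b = 1 then Real.exp (δs ν 1 * (L₁ ν + L₂ ν)) • U ν 1 + Real.exp (δs ν 4 * (L₁ ν + L₂ ν)) • U ν 4
          else if b = 4 then (δs ν 4 - δs ν 1) • (Real.exp (δs ν 4 * (L₁ ν + L₂ ν)) • U ν 4)
          else if b = 5 then (δs ν 5 - δs ν 0) • (Real.exp (δs ν 5 * (L₁ ν + L₂ ν)) • U ν 5) else Real.exp (δs ν b * (L₁ ν + L₂ ν)) • U ν b) / μ₃ ν) atTop (𝓝 (Γ₃ a b))) →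
      (Γ₁ 0 4 ≠ 0 ∨ Γ₁ 5 1 ≠ 0) → (Γ₂ 0 4 ≠ 0 ∨ Γ₂ 5 1 ≠ 0) → (Γ₃ 0 4 ≠ 0 ∨ Γ₃ 5 1 ≠ 0) → False

open Filter in
open Summit.ValiantsHypothesis.ValiantsHypothesis.Theorems.LacunarySymmetroidMatrixDescartes.WallBubbling.Bubbling (polar) in
/-- (rev 9) **`MixThree26'` — THE C′ RETYPE OF THE THREE-SCALE RULE** (desk R3024 (i), crit-5 g4's repair text, frozen 05:09:39Z): rev-8 `MixThree26` with the symmetry binder `(∀ ν l, (U ν l).IsSymm) →` inserted immediately after the `U` binder and door-p2 g14's binder `δ0 0 ≠ δ0 1 →` after the face equalities (R3024 (iii)); everything else byte-identical.  On Sym₂(ℝ) `polar` (= the polarisation of `det`) has signature (1,2) and only isotropic LINES, so crit-5's plane witness does not apply.  OPEN, typed, never asserted; the genuinely open multi-pair residual of (W_wall) once TOP/MID are kernel (R3024 (v)); crit-5's pigeonhole sketch (rank-one cross block, each class ratio bounded at ≤ 1 of 3 scales when δ0₀ ≠ δ0₁) is a skeleton for the W1 successor, not a proof.  W1's #52′ must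 carry this binder list BYTE-EXACT. -/
def MixThree26' : Prop :=
  ∀ (δ0 : Fin 6 → ℝ), δ0 5 = δ0 0 → δ0 4 = δ0 1 → δ0 0 ≠ δ0 1 →
    ∀ (δs : ℕ → Fin 6 → ℝ), (∀ l, Tendsto (fun ν => δs ν l) atTop (𝓝 (δ0 l))) →
      ∀ (U : ℕ → Fin 6 → Matrix (Fin 2) (Fin 2) ℝ), (∀ ν l, (U ν l).IsSymm) → ∀ (L₁ L₂ : ℕ → ℝ), Tendsto L₁ atTop atTop → Tendsto L₂ atTop atTop →
      ∀ (μ₁ μ₂ μ₃ : ℕ → ℝ), (∀ ν, 0 < μ₁ ν) → (∀ ν, 0 < μ₂ ν) → (∀ ν, 0 < μ₃ ν) →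
      (∀ ν a b, |polar (if a = 0 then U ν 0 + U ν 5 else if a = 1 then U ν 1 + U ν 4
          else if a = 4 then (δs ν 4 - δs ν 1) • U ν 4 else if a = 5 then (δs ν 5 - δs ν 0) • U ν 5 else U ν a)
        (if b = 0 then U ν 0 + U ν 5 else if b = 1 then U ν 1 + U ν 4
          else if b = 4 then (δs ν 4 - δs ν 1) • U ν 4 else if b = 5 then (δs ν 5 - δs ν 0) • U ν 5 else U ν b)| ≤ μ₁ ν) →
      (∀ ν a b, |polar (if a = 0 then Real.exp (δs ν 0 * L₁ ν) • U ν 0 + Real.exp (δs ν 5 * L₁ ν) • U ν 5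
          else if a = 1 then Real.exp (δs ν 1 * L₁ ν) • U ν 1 + Real.exp (δs ν 4 * L₁ ν) • U ν 4
          else if a = 4 then (δs ν 4 - δs ν 1) • (Real.exp (δs ν 4 * L₁ ν) • U ν 4)
          else if a = 5 then (δs ν 5 - δs ν 0) • (Real.exp (δs ν 5 * L₁ ν) • U ν 5) else Real.exp (δs ν a * L₁ ν) • U ν a)
        (if b = 0 then Real.exp (δs ν 0 * L₁ ν) • U ν 0 + Real.exp (δs ν 5 * L₁ ν) • U ν 5
          else if b = 1 then Real.exp (δs ν 1 * L₁ ν) • U ν 1 + Real.exp (δs ν 4 * L₁ ν) • U ν 4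
          else if b = 4 then (δs ν 4 - δs ν 1) • (Real.exp (δs ν 4 * L₁ ν) • U ν 4)
          else if b = 5 then (δs ν 5 - δs ν 0) • (Real.exp (δs ν 5 * L₁ ν) • U ν 5) else Real.exp (δs ν b * L₁ ν) • U ν b)| ≤ μ₂ ν) →
      (∀ ν a b, |polar (if a = 0 then Real.exp (δs ν 0 * (L₁ ν + L₂ ν)) • U ν 0 + Real.exp (δs ν 5 * (L₁ ν + L₂ ν)) • U ν 5
          else if a = 1 then Real.exp (δs ν 1 * (L₁ ν + L₂ ν)) • U ν 1 + Real.exp (δs ν 4 * (L₁ ν + L₂ ν)) • U ν 4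
          else if a = 4 then (δs ν 4 - δs ν 1) • (Real.exp (δs ν 4 * (L₁ ν + L₂ ν)) • U ν 4)
          else if a = 5 then (δs ν 5 - δs ν 0) • (Real.exp (δs ν 5 * (L₁ ν + L₂ ν)) • U ν 5) else Real.exp (δs ν a * (L₁ ν + L₂ ν)) • U ν a)
        (if b = 0 then Real.exp (δs ν 0 * (L₁ ν + L₂ ν)) • U ν 0 + Real.exp (δs ν 5 * (L₁ ν + L₂ ν)) • U ν 5
          else if b = 1 then Real.exp (δs ν 1 * (L₁ ν + L₂ ν)) • U ν 1 + Real.exp (δs ν 4 * (L₁ ν + L₂ ν)) • U ν 4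
          else if b = 4 then (δs ν 4 - δs ν 1) • (Real.exp (δs ν 4 * (L₁ ν + L₂ ν)) • U ν 4)
          else if b = 5 then (δs ν 5 - δs ν 0) • (Real.exp (δs ν 5 * (L₁ ν + L₂ ν)) • U ν 5) else Real.exp (δs ν b * (L₁ ν + L₂ ν)) • U ν b)| ≤ μ₃ ν) →
      ∀ (Γ₁ Γ₂ Γ₃ : Fin 6 → Fin 6 → ℝ),
      (∀ a b, Tendsto (fun ν => polar (if a = 0 then U ν 0 + U ν 5 else if a = 1 then U ν 1 + U ν 4
          else if a = 4 then (δs ν 4 - δs ν 1) • U ν 4 else if a = 5 then (δs ν 5 - δs ν 0) • U ν 5 else U ν a)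
        (if b = 0 then U ν 0 + U ν 5 else if b = 1 then U ν 1 + U ν 4
          else if b = 4 then (δs ν 4 - δs ν 1) • U ν 4 else if b = 5 then (δs ν 5 - δs ν 0) • U ν 5 else U ν b) / μ₁ ν) atTop (𝓝 (Γ₁ a b))) →
      (∀ a b, Tendsto (fun ν => polar (if a = 0 then Real.exp (δs ν 0 * L₁ ν) • U ν 0 + Real.exp (δs ν 5 * L₁ ν) • U ν 5
          else if a = 1 then Real.exp (δs ν 1 * L₁ ν) • U ν 1 + Real.exp (δs ν 4 * L₁ ν) • U ν 4
          else if a = 4 then (δs ν 4 - δs ν 1) • (Real.exp (δs ν 4 * L₁ ν) • U ν 4)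
          else if a = 5 then (δs ν 5 - δs ν 0) • (Real.exp (δs ν 5 * L₁ ν) • U ν 5) else Real.exp (δs ν a * L₁ ν) • U ν a)
        (if b = 0 then Real.exp (δs ν 0 * L₁ ν) • U ν 0 + Real.exp (δs ν 5 * L₁ ν) • U ν 5
          else if b = 1 then Real.exp (δs ν 1 * L₁ ν) • U ν 1 + Real.exp (δs ν 4 * L₁ ν) • U ν 4
          else if b = 4 then (δs ν 4 - δs ν 1) • (Real.exp (δs ν 4 * L₁ ν) • U ν 4)
          else if b = 5 then (δs ν 5 - δs ν 0) • (Real.exp (δs ν 5 * L₁ ν) • U ν 5) else Real.exp (δs ν b * L₁ ν) • U ν b) / μ₂ ν) atTop (𝓝 (Γ₂ a b))) →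
      (∀ a b, Tendsto (fun ν => polar (if a = 0 then Real.exp (δs ν 0 * (L₁ ν + L₂ ν)) • U ν 0 + Real.exp (δs ν 5 * (L₁ ν + L₂ ν)) • U ν 5
          else if a = 1 then Real.exp (δs ν 1 * (L₁ ν + L₂ ν)) • U ν 1 + Real.exp (δs ν 4 * (L₁ ν + L₂ ν)) • U ν 4
          else if a = 4 then (δs ν 4 - δs ν 1) • (Real.exp (δs ν 4 * (L₁ ν + L₂ ν)) • U ν 4)
          else if a = 5 then (δs ν 5 - δs ν 0) • (Real.exp (δs ν 5 * (L₁ ν + L₂ ν)) • U ν 5) else Real.exp (δs ν a * (L₁ ν + L₂ ν)) • U ν a)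
        (if b = 0 then Real.exp (δs ν 0 * (L₁ ν + L₂ ν)) • U ν 0 + Real.exp (δs ν 5 * (L₁ ν + L₂ ν)) • U ν 5
          else if b = 1 then Real.exp (δs ν 1 * (L₁ ν + L₂ ν)) • U ν 1 + Real.exp (δs ν 4 * (L₁ ν + L₂ ν)) • U ν 4
          else if b = 4 then (δs ν 4 - δs ν 1) • (Real.exp (δs ν 4 * (L₁ ν + L₂ ν)) • U ν 4)
          else if b = 5 then (δs ν 5 - δs ν 0) • (Real.exp (δs ν 5 * (L₁ ν + L₂ ν)) • U ν 5) else Real.exp (δs ν b * (L₁ ν + L₂ ν)) • U ν b) / μ₃ ν) atTop (𝓝 (Γ₃ a b))) →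
      (Γ₁ 0 4 ≠ 0 ∨ Γ₁ 5 1 ≠ 0) → (Γ₂ 0 4 ≠ 0 ∨ Γ₂ 5 1 ≠ 0) → (Γ₃ 0 4 ≠ 0 ∨ Γ₃ 5 1 ≠ 0) → False

/-- (rev 8; **rev 9: VACUOUS — its hypothesis `MixThree26` is FALSE as typed (crit-5 g4 kernel); the contentful link is the target `Stmt.weylFaces_wall_of_mixedRulesR` below, over `MixThree26'`**) KERNEL LINK: **(W_wall) ⟸ MixTop26 ∧ MixMid26 ∧ MixThree26** for THIS file's definitions — W1 #43 `weylFaces_wall_of_twoPairChains`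
composed with W1 #52 `twoPair_noTwenties_of_mixedRules` (rules instantiated AT THE FACE `δ0`, where `h50`/`h41` are in context) and the wall
non-degeneracies W1 #26d/#26b; the `hgen` reshuffles are #53's.  This is #53's headline with the face-form binders — the reduction of record. -/
theorem weylFaces_wall_of_mixedRules' (hT : MixTop26) (hM : MixMid26) (h3 : MixThree26) : Stmt.weylFaces_wall :=
  fun δ hδ hW hMx hV =>
    Summit.ValiantsHypothesis.ValiantsHypothesis.Theorems.LacunarySymmetroidMatrixDescartes.WallBubbling.weylFaces_wall_of_twoPairChains
      (fun δs δ0 hδ0 h50 h41 hrel hgen U hU hne z hz hroot =>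
        Summit.ValiantsHypothesis.ValiantsHypothesis.Theorems.LacunarySymmetroidMatrixDescartes.WallBubbling.twoPair_noTwenties_of_mixedRules δ0 h50 h41
          (hT δ0 h50 h41) (hM δ0 h50 h41) (h3 δ0 h50 h41)
          (fun a b c e h => (hgen a b c e h).elim Or.inl (fun h2 => h2.elim (fun x => Or.inr (Or.inl x))
            (fun x => Or.inr (Or.inr (Or.inl x)))))
          (fun W hWs hW' =>
            Summit.ValiantsHypothesis.ValiantsHypothesis.Theorems.LacunarySymmetroidMatrixDescartes.WallBubbling.doublyConfluentDet_ne_zero_of_polar_ne_zero_wallC1 δ0 h50 h41 hrel hgen W hWs hW')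
          δs hδ0 U hU hne z hz hroot)
      (fun δs δ0 hδ0 h50 h41 hrel hgen U hU hne z hz hroot =>
        Summit.ValiantsHypothesis.ValiantsHypothesis.Theorems.LacunarySymmetroidMatrixDescartes.WallBubbling.twoPair_noTwenties_of_mixedRules δ0 h50 h41
          (hT δ0 h50 h41) (hM δ0 h50 h41) (h3 δ0 h50 h41)
          (fun a b c e h => (hgen a b c e h).elim Or.inl (fun h2 => h2.elim (fun x => Or.inr (Or.inl x))
            (fun x => Or.inr (Or.inr (Or.inr x)))))
          (fun W hWs hW' =>
            Summit.ValiantsHypothesis.ValiantsHypothesis.Theorems.LacunarySymmetroidMatrixDescartes.WallBubbling.doublyConfluentDet_ne_zero_of_polar_ne_zero_wallC2 δ0 h50 h41 hrel hgen W hWs hW')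
          δs hδ0 U hU hne z hz hroot)
      δ hδ hW hMx hV

/-- (rev 8; **rev 9: VACUOUS as a ledger — `m3 : MixThree26` is refuted; the ledger of record is `weylFaces_of_doorsNC_mixedRulesR` below**) THE (W) LEDGER after rev 8, kernel bookkeeping: **(W) ⟸ ConfluentDoor26 ∧ NoTightChain26NC ∧ (M) ∧ ValueGenericTwoPairChain26 ∧
ValueGenericThreePairChain26 ∧ TripleStratum26 ∧ MixTop26 ∧ MixMid26 ∧ MixThree26** — all nine OPEN, typed, never asserted (the one-pair part
of (W_wall) is W1 #42, the multi-pair part is now the three face-form mixed-class rules). -/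
theorem weylFaces_of_doorsNC_mixedRules (hdoor : ConfluentDoor26) (hnc : NoTightChain26NC) (hM : Stmt.stub_mixedWalls)
    (h2 : ValueGenericTwoPairChain26) (h3 : ValueGenericThreePairChain26) (hT : TripleStratum26)
    (mT : MixTop26) (mM : MixMid26) (m3 : MixThree26) : Stmt.stub_weylFaces :=
  weylFaces_of_doorsNC hdoor hnc
    (weylFaces_deep_of_split hM (weylFaces_deepVal_of_chains' h2 h3 hT) (weylFaces_wall_of_mixedRules' mT mM m3))


/-- (rev 9) THE RE-LINK TARGET: **(W_wall) ⟸ MixTop26 ∧ MixMid26 ∧ MixThree26'** for THIS file's definitions.  OPEN HERE, typed, never asserted: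
it is W1's retyped #52′ (`twoPair_noTwenties_of_mixedRules` with the `IsSymm`-weakened three-scale binder; the application sites carry `hU`)
composed with W1 #43 `weylFaces_wall_of_twoPairChains` and the wall non-degeneracies #26d/#26b exactly as rev 8's (now vacuous)
`weylFaces_wall_of_mixedRules'` composes the unprimed #52 — to be PROVED in the next rev of this file once #52′ is ACCEPTED and built (a theorem
`weylFaces_wall_of_mixedRulesR_holds : Stmt.weylFaces_wall_of_mixedRulesR`), not before. -/
def Stmt.weylFaces_wall_of_mixedRulesR : Prop := MixTop26 → MixMid26 → MixThree26' → Stmt.weylFaces_wall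

/-- (rev 9) THE (W) LEDGER after rev 9, kernel bookkeeping CONDITIONAL on the re-link: **(W) ⟸ (re-link) ∧ ConfluentDoor26 ∧ NoTightChain26NC ∧ (M) ∧
ValueGenericTwoPairChain26 ∧ ValueGenericThreePairChain26 ∧ TripleStratum26 ∧ MixTop26 ∧ MixMid26 ∧ MixThree26'** — every hypothesis OPEN, typed, never
asserted (TOP kernel-pending by W1 #54; the re-link pending W1 #52′). -/
theorem weylFaces_of_doorsNC_mixedRulesR (hlink : Stmt.weylFaces_wall_of_mixedRulesR) (hdoor : ConfluentDoor26) (hnc : NoTightChain26NC)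
    (hM : Stmt.stub_mixedWalls) (h2 : ValueGenericTwoPairChain26) (h3 : ValueGenericThreePairChain26) (hT : TripleStratum26)
    (mT : MixTop26) (mM : MixMid26) (m3 : MixThree26') : Stmt.stub_weylFaces :=
  weylFaces_of_doorsNC hdoor hnc
    (weylFaces_deep_of_split hM (weylFaces_deepVal_of_chains' h2 h3 hT) (hlink mT mM m3))


/-! ### rev 11 — kernel links by name (W1 door-p2 g14 #55, #60, #62 ACCEPTED) and the six-hypothesis (W) ledger -/

/-- (rev 11) KERNEL LINK, UNCONDITIONAL: W1 door-p2 g14 #55 `…WallBubblingMixMid.mixMid_face` (p698802) proves rule «MID» for THIS file's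
`MixMid26` — by name, the verbatim statement unfolding definitionally. -/
theorem MixMid26_holds : MixMid26 :=
  fun δ0 h50 h41 =>
    Summit.ValiantsHypothesis.ValiantsHypothesis.Theorems.LacunarySymmetroidMatrixDescartes.WallBubbling.mixMid_face δ0 h50 h41

/-- (rev 11) KERNEL LINK, UNCONDITIONAL: W1 door-p2 g14 #60 `…WallBubblingMixThree.mixThree_face'` (p700713) proves C′-THREE = THIS file's
`MixThree26'` (the rev-9 retype with the `IsSymm` binder and `δ0 0 ≠ δ0 1`) — by name. -/
theorem MixThree26'_holds : MixThree26' :=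
  fun δ0 h50 h41 h01 =>
    Summit.ValiantsHypothesis.ValiantsHypothesis.Theorems.LacunarySymmetroidMatrixDescartes.WallBubbling.mixThree_face' δ0 h50 h41 h01

/-- (rev 11) KERNEL LINK, UNCONDITIONAL: W1 door-p2 g14 #62 `…WallBubblingWallClosure.weylFaces_wall_closed` (p701060 @ee6351b9239b) proves
**(W_wall) = THIS file's `Stmt.weylFaces_wall` OUTRIGHT** — door-free, hypothesis-free; its statement is `Stmt.weylFaces_wall` with `SortedSimplex`,
`HasWeylCoincidence`, `HasMixedCoincidence`, `IsValueGeneric`, `TwentyLocus` inlined (verbatim copies, unfolding definitionally). -/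
theorem Stmt.weylFaces_wall_holds : Stmt.weylFaces_wall :=
  fun δ hδ hW hM hV =>
    Summit.ValiantsHypothesis.ValiantsHypothesis.Theorems.LacunarySymmetroidMatrixDescartes.WallBubbling.weylFaces_wall_closed δ hδ hW hM hV

/-- (rev 11) The multi-pair part of (W_wall) (rev 7) closes by restriction of `Stmt.weylFaces_wall_holds`. -/
theorem weylFaces_wall_multiPair_holds : Stmt.weylFaces_wall_multiPair :=
  fun δ hδ hW hM hV _ => Stmt.weylFaces_wall_holds δ hδ hW hM hV

/-- (rev 11) The rev-9 re-link target `MixTop26 → MixMid26 → MixThree26' → Stmt.weylFaces_wall` closes by weakening (its conclusion is now a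
theorem); W1 #62's proof is exactly that composition (#61 `twoPair_noTwenties_of_mixedRules'` ∘ #54/#55/#60 ∘ #26d/#26b inside #43), performed in
`Theorems/`, so no separate #52′ link is needed here. -/
theorem weylFaces_wall_of_mixedRulesR_holds : Stmt.weylFaces_wall_of_mixedRulesR :=
  fun _ _ _ => Stmt.weylFaces_wall_holds

/-- (rev 11) (W_deep) ⟸ (M) ∧ ValueGenericTwoPairChain26 ∧ ValueGenericThreePairChain26 ∧ TripleStratum26 — the wall conjunct discharged in the kernel. -/
theorem weylFaces_deep_of_strata (hM : Stmt.stub_mixedWalls) (h2 : ValueGenericTwoPairChain26) (h3 : ValueGenericThreePairChain26)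
    (hT : TripleStratum26) : Stmt.weylFaces_deep :=
  weylFaces_deep_of_split hM (weylFaces_deepVal_of_chains' h2 h3 hT) Stmt.weylFaces_wall_holds

/-- (rev 11) THE (W) LEDGER after rev 11, kernel bookkeeping: **(W) ⟸ ConfluentDoor26 ∧ NoTightChain26NC ∧ (M) ∧ ValueGenericTwoPairChain26 ∧
ValueGenericThreePairChain26 ∧ TripleStratum26** — SIX hypotheses, all OPEN, typed, never asserted ((W_wall) is kernel, W1 #62; the mixed-class
rules TOP/MID/C′-THREE are kernel, #54/#55/#60).  `ValueGenericTwoPairChain26` is W1's announced #63. -/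
theorem weylFaces_of_doorsNC_strata_wallClosed (hdoor : ConfluentDoor26) (hnc : NoTightChain26NC) (hM : Stmt.stub_mixedWalls)
    (h2 : ValueGenericTwoPairChain26) (h3 : ValueGenericThreePairChain26) (hT : TripleStratum26) : Stmt.stub_weylFaces :=
  weylFaces_of_doorsNC hdoor hnc (weylFaces_deep_of_strata hM h2 h3 hT)


/-! ### rev 12 — kernel link by name (W1 door-p2 g14 #63 ACCEPTED) and the five-hypothesis (W) ledger -/

/-- (rev 12) KERNEL LINK, UNCONDITIONAL: W1 door-p2 g14 #63 `…WallBubblingValueGenericTwoPairChain.valueGenericTwoPairChain` (p701493) proves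
`ValueGenericTwoPairChain26` (W1 #44's hypothesis `hVG2`, rev 7) — by name, token-exact statement. -/
theorem ValueGenericTwoPairChain26_holds : ValueGenericTwoPairChain26 :=
  Summit.ValiantsHypothesis.ValiantsHypothesis.Theorems.LacunarySymmetroidMatrixDescartes.WallBubbling.valueGenericTwoPairChain

/-- (rev 12) (W_deepVal) ⟸ ValueGenericThreePairChain26 ∧ TripleStratum26 — the two-pair chain discharged in the kernel. -/
theorem weylFaces_deepVal_of_threePair_triple (h3 : ValueGenericThreePairChain26) (hT : TripleStratum26) : Stmt.weylFaces_deepVal :=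
  weylFaces_deepVal_of_chains' ValueGenericTwoPairChain26_holds h3 hT

/-- (rev 12) THE (W) LEDGER after rev 12, kernel bookkeeping: **(W) ⟸ ConfluentDoor26 ∧ NoTightChain26NC ∧ (M) ∧ ValueGenericThreePairChain26 ∧
TripleStratum26** — FIVE hypotheses, all OPEN, typed, never asserted. -/
theorem weylFaces_of_doorsNC_strata5 (hdoor : ConfluentDoor26) (hnc : NoTightChain26NC) (hM : Stmt.stub_mixedWalls)
    (h3 : ValueGenericThreePairChain26) (hT : TripleStratum26) : Stmt.stub_weylFaces :=
  weylFaces_of_doorsNC_strata_wallClosed hdoor hnc hM ValueGenericTwoPairChain26_holds h3 hT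


/-! ### rev 13 — kernel link by name (W1 door-p2 g14 #79 ACCEPTED) and the four-hypothesis (W) ledger -/

/-- (rev 13) KERNEL LINK, UNCONDITIONAL: W1 door-p2 g14 #79 `…WallBubblingValueGenericThreePairChain.valueGenericThreePairChain` (p706782) proves
`ValueGenericThreePairChain26` (rev 7's hypothesis `h3`) — by name, token-exact statement. -/
theorem ValueGenericThreePairChain26_holds : ValueGenericThreePairChain26 :=
  Summit.ValiantsHypothesis.ValiantsHypothesis.Theorems.LacunarySymmetroidMatrixDescartes.WallBubbling.valueGenericThreePairChain

/-- (rev 13) (W_deepVal) ⟸ TripleStratum26 alone — both value-generic chains discharged in the kernel. -/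
theorem weylFaces_deepVal_of_triple (hT : TripleStratum26) : Stmt.weylFaces_deepVal :=
  weylFaces_deepVal_of_threePair_triple ValueGenericThreePairChain26_holds hT

/-- (rev 13) THE (W) LEDGER after rev 13, kernel bookkeeping: **(W) ⟸ ConfluentDoor26 ∧ NoTightChain26NC ∧ (M) ∧ TripleStratum26** — FOUR
hypotheses, all OPEN, typed, never asserted. -/
theorem weylFaces_of_doorsNC_strata4 (hdoor : ConfluentDoor26) (hnc : NoTightChain26NC) (hM : Stmt.stub_mixedWalls)
    (hT : TripleStratum26) : Stmt.stub_weylFaces :=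
  weylFaces_of_doorsNC_strata5 hdoor hnc hM ValueGenericThreePairChain26_holds hT

end

end Summit.ValiantsHypothesis.ValiantsHypothesis.Cruxes.DoorA26.WallBubbling.ConfluentDoor
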